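import Literature.MathematicalPhysics.QuantumFieldTheory.Balaban1983to89.B1Eq324BenfattoKernelSect5UpperStep
import Literature.MathematicalPhysics.QuantumFieldTheory.Balaban1983to89.B1Eq324BenfattoKernelSect5PavementChain
import Literature.MathematicalPhysics.QuantumFieldTheory.Balaban1983to89.B1Eq324BenfattoKernelCondTranslation
import Literature.MathematicalPhysics.QuantumFieldTheory.Balaban1983to89.B1Eq324BenfattoSect5UpperStep
import HarnessLib

/-!
# `Balaban1983to89.B1Eq324BenfattoKernelSect5PavementChainUpper` — [BenfattoEtAl1978] §5 p. 159 «(5.12) can be bounded above by the r.h.s. of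
# (5.35) with b replaced by γ⁻¹b», iterated over displaced pavements, FOR THE CLASS of [Balaban1985BackgroundPropagators] Sect. E p. 428:
# the UPPER PAVEMENT CHAIN under the conditioned class field `P̄^K_{C,z̄}`, the analytic rows discharged from the class constants, PROVED

statement-level skeleton of published theorems with citation tags; proofs where landed; nothing here is a claim about the
Yang–Mills mass gap

WHY THIS MODULE (cell `pub-ymgap`, seat `dag-n08-d` gen 13, INTENT-60; node N08 [Balaban1985UV3]; the [BenfattoEtAl1978] source chain behind the
(α)-row `h324`; row S8b of `N08-PORT-MAP-STRUCTURAL-SIDE.md`).  The (4.6)-side twin of `…KernelSect5PavementChain` (S8a): the one full upper step under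
`P̄^K_{C,z̄} = (μ_{C^C}).map(m^K_{C,z̄} + ·)` for the class (`…KernelSect5UpperStep.upperPavementStep_cond_of_setIntegral`, p613344) carries the analytic
rows `hr`/`hrmax`/`hT`/`hu` and a labelling as hypotheses; §1 discharges them from the class constants `(γ_A, θ, J_c, V, M)` exactly as
`…KernelSect5ClassRows` does for the lower step (the cross-row sum over `Λ − (C ∪ Γ₁)` is dominated by seat n08-w5's sum over `Λ − Γ₁`; the centre row
is `abs_condMean_union_le_of_classRows`, `C_u = VM/(γ_A − J_c)`), and removes the smallness hypothesis on `z̄` («then assuming |z_Δ| ≦ b(1+d(Δ,I)),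
∀Δ ∈ C», p. 159: otherwise the integral vanishes, `P̄^K_{C,z̄}`-a.s. the field IS `z̄` on `C`).  §2–§3 move it to drifting frames: translating the datum AND
the conditioning datum by `τ` turns `P̄^{K(·+τ,·+τ)}_{C,ζ}` into `P̄^{K}_{C+τ,ζ(·−τ)}` (`…KernelCondTranslation.integral_condFieldK_comp_translate`), and the
class is shift-closed with the same constants (S8a §1).  §4 chains `n` steps by `…Sect5PavementChain.le_exp_sum_mul_of_steps` with the concrete
module's measure-free recursion, and closes with the terminal conditioned volume `≤ 1`.

WHAT IS PROVED (standard axioms; no `sorry`; no definition).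
* §1 `mem_sdiff_corridors_of_mem_sdiff_union`, `cross_rowSum_union_le_of_class_pavement` (the cross-row sum over `Λ − (C ∪ Γ₁)` for the labelling
  induced from `Λ − Γ₁`); `integral_cutoffBoltzmann_condFieldK_eq_zero_of_not_mem` (for the class kernel and `C ⊆ Λ`: if `z̄` is not small on `C` the
  (4.6)-integral vanishes); ★★ `upperPavementStep_of_classRows` (rows discharged, `z̄` small on `C`) and ★★ `upperPavementStep_of_classRows'` (ANY `z̄`).
* §2 `integral_cutoffBoltzmann_condFieldK_frame` (`∫Π_Δχ̂^I_b e^{H^A_J} dP̄^{G(·+τ,·+τ)}_{C,ζ} = ∫Π_Δχ̂^{I+τ}_b e^{H^{A(·−τ)}_{J+τ}} dP̄^G_{C+τ,ζ(·−τ)}`).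
* §3 ★★ `upperPavementStep_of_classRows_frame` — one displaced class upper step (member in frame `σ`, datum and conditioning datum translated by `τ`).
* §4 ★★★ `upperPavementChainCond` — `n` displaced class upper steps along `J_{k+1} = (J_k + τ_k) ∩ Γ̄₁(B_k)`, `I_{k+1} = I_k + τ_k`,
  `A_{k+1} = (A_k(·−τ_k))|_{Γ̄₁(B_k)}`, `C_{k+1} = C_k + τ_k`, `z̄_{k+1} = z̄_k∘(·−τ_k)`, `γb_{k+1} = b_k`, `σ_0 = 0`, `σ_{k+1} = σ_k − τ_k`:
  `∫Π_Δχ̂^{I_0}_{γb_0}e^{H^{A_0}_{J_0}}dP̄^K_{C_0,z̄_0} ≤ exp(Σ_{k<n}(err₅₁₁(k) + err₅₃₄(k) + 2P′_k + Σ_{□∈B_k}u_k(□)))·∫Π_Δχ̂^{I_n}_{γb_n}e^{H^{A_n}_{J_n}}dP̄^{K(·+σ_n,·+σ_n)}_{C_n,z̄_n}`;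
  ★★ `upperPavementChainCond_le_exp` — `d + 1` separated steps end in the free case and the terminal conditioned volume is `≤ 1`.
* §5 (v1.1) `partKernel_row_sdiff_of_disjoint` — the parts adapter: standard part kernels serve the conditional / upper steps when `C` misses the boxes.
* §6 (v1.2) ★★ `upperPavementChainCond_le_exp_of_eq_empty` — the driver AT THE STOPPING INDEX: `n` steps, `J_n = ∅` in place of the separation of the
  displacements (no price is paid on an empty pavement), `C_0 ⊆ Λ`.
HONEST SCOPE.  The upper ((4.6)-side) chain for the class only; the per-box UPPER bounds `hbox` stay displayed at every step (the cluster side discharges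
them); the identification of `Σ_□u_□` with truncated expectations and the error ledger (print's (O1′)/(O2′)) are the assembly layer (seat n08-c), NOT here;
the class, the temperature-zero substitute for (5.13) and the bounded-fluctuation device are OURS, not print's; nothing of [Balaban1985UV3] /
[Balaban1985UV2] is asserted; NO generalised Basic Lemma is stated here; the port is not commissioned; count-neutral for N08; nothing about d = 4, the
continuum, OS axioms, a mass gap or the Clay problem.
-/

noncomputable section

open MeasureTheory ProbabilityTheory Finset Matrix
open scoped BigOperators Matrix

namespace Literature.MathematicalPhysics.QuantumFieldTheory.Balaban1983to89.B1Eq324BenfattoKernelSect5PavementChainUpper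

open Literature.MathematicalPhysics.QuantumFieldTheory
open Literature.MathematicalPhysics.QuantumFieldTheory.GaussianToolkit
open Literature.MathematicalPhysics.QuantumFieldTheory.Balaban1983to89.B1Eq324BenfattoLemma
open Literature.MathematicalPhysics.QuantumFieldTheory.Balaban1983to89.B1Eq324BenfattoKernelRegression
open Literature.MathematicalPhysics.QuantumFieldTheory.Balaban1983to89.B1Eq324BenfattoKernelOfPrecision
open Literature.MathematicalPhysics.QuantumFieldTheory.Balaban1983to89.B1Eq324BenfattoKernelCondField
open Literature.MathematicalPhysics.QuantumFieldTheory.Balaban1983to89.B1Eq324BenfattoKernelCondTranslation (integral_condFieldK_comp_translate)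
open Literature.MathematicalPhysics.QuantumFieldTheory.Balaban1983to89.B1Eq324BenfattoKernelSect5Iteration
open Literature.MathematicalPhysics.QuantumFieldTheory.Balaban1983to89.B1Eq324BenfattoKernelSect5ClassRows
open Literature.MathematicalPhysics.QuantumFieldTheory.Balaban1983to89.B1Eq324BenfattoKernelSect5UpperStep
open Literature.MathematicalPhysics.QuantumFieldTheory.Balaban1983to89.B1Eq324BenfattoKernelSect5PavementChain (l2_translate submatrix_translate_row_le
  translate_row_le)
open Literature.MathematicalPhysics.QuantumFieldTheory.Balaban1983to89.B1Eq324BenfattoSect5PavementChain (chain_invariants chain_eq_empty_of_sep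
  coefSupportedIn_frame abs_shiftCoef_neg_le shiftCoef_shiftCoef_neg cutoffBoltzmann_frame le_exp_sum_mul_of_steps)
open Literature.MathematicalPhysics.QuantumFieldTheory.Balaban1983to89.B1Eq324BenfattoSect5UpperStep (integral_cutoffBoltzmann_nonneg)
open Literature.MathematicalPhysics.QuantumFieldTheory.Balaban1983to89.B1Eq324BenfattoKernelSect5Termination (integral_cutoffBoltzmann_empty_measure)
open Literature.MathematicalPhysics.QuantumFieldTheory.Balaban1983to89.B1Eq324BenfattoClassCrossRowMass (cross_rowSum_le_of_class_pavement crossRow_le_rmax)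
open Literature.MathematicalPhysics.QuantumFieldTheory.Balaban1983to89.B1Eq324BenfattoClassCrossRowMassMoment (rowDefect_cubeDist_le_of_rowDefect_sqrt)
open Literature.MathematicalPhysics.QuantumFieldTheory.Balaban1983to89.B1Eq324BenfattoClassAppendixC (posDef_of_coercive)
open Literature.MathematicalPhysics.QuantumFieldTheory.Balaban1983to89.B1Eq324BenfattoAppendixA (distToRegion_nonneg)
open Literature.MathematicalPhysics.QuantumFieldTheory.Balaban1983to89.B1Eq324BenfattoSect5Boxes
open Literature.MathematicalPhysics.QuantumFieldTheory.Balaban1983to89.B1Eq324BenfattoSect5Eq511 (s1Const)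
open Literature.MathematicalPhysics.QuantumFieldTheory.Balaban1983to89.B1Eq324BenfattoSect5Eq524 (psi1p psi2)
open Literature.MathematicalPhysics.QuantumFieldTheory.Balaban1983to89.B1Eq324BenfattoSect5Eq534 (corridorsBar)
open Literature.MathematicalPhysics.QuantumFieldTheory.Balaban1983to89.B1Eq324BenfattoSect5Iteration
open Literature.MathematicalPhysics.QuantumFieldTheory.Balaban1983to89.B1Eq324BenfattoSect5Termination (hamiltonian_empty)
open Literature.MathematicalPhysics.QuantumFieldTheory.Balaban1983to89.B1Eq324BenfattoSect5Eq515

variable {d : ℕ}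

/-! ## §1  The upper step under `P̄^K_{C,z̄}`, the analytic rows discharged from the class constants -/

section Labels

/-- `Λ − (C ∪ Γ₁) ⊆ Λ − Γ₁`, as a membership transport. [folklore] [cite: BenfattoEtAl1978, §5 p.155 (class form)] -/
theorem mem_sdiff_corridors_of_mem_sdiff_union {Λ B C : Finset (B1Eq324BenfattoLemma.Site d)} {L w : ℕ} {y : B1Eq324BenfattoLemma.Site d}
    (hy : y ∈ Λ \ (C ∪ corridors L w B)) : y ∈ Λ \ corridors L w B :=
  Finset.mem_sdiff.mpr ⟨(Finset.mem_sdiff.mp hy).1, fun h => (Finset.mem_sdiff.mp hy).2 (Finset.mem_union_right C h)⟩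

/-- **The cross-row sum over the SMALLER index set `Λ − (C ∪ Γ₁)` of the conditional / upper steps** is dominated by seat n08-w5's cross-row sum over
`Λ − Γ₁` (`…ClassCrossRowMass.cross_rowSum_le_of_class_pavement`) for the labelling INDUCED from a labelling of `Λ − Γ₁`: the summands are non-negative
and the small sum is a sub-sum of the large one.  So `r_y = J/(cosh(κ·max(w, d(Δ_y, ∪B))) − 1)` serves the conditional step too.
[cite: BenfattoEtAl1978, §5 (5.13) p.155, (5.36) p.159 (class substitute; ours)] -/
theorem cross_rowSum_union_le_of_class_pavement {Λ : Finset (B1Eq324BenfattoLemma.Site d)} {A : Matrix Λ Λ ℝ} {κ J : ℝ} (hκ : 0 < κ)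
    (hJ : ∀ e : Λ, ∑ e' : Λ, |A e e'| *
      (Real.cosh (κ * cubeDist (e : B1Eq324BenfattoLemma.Site d) (e' : B1Eq324BenfattoLemma.Site d)) - 1) ≤ J)
    {L w : ℕ} (hL : 0 < L) (hw : 0 < w) (B C : Finset (B1Eq324BenfattoLemma.Site d))
    (π : ↥(Λ \ corridors L w B) → Option ↥B)
    (hπ : ∀ (y : ↥(Λ \ corridors L w B)) (m₁ : ↥B), π y = some m₁ ↔ (y : B1Eq324BenfattoLemma.Site d) ∈ shrink L (m₁ : B1Eq324BenfattoLemma.Site d) w)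
    (y : ↥(Λ \ (C ∪ corridors L w B))) :
    ∑ y' : ↥(Λ \ (C ∪ corridors L w B)), (if π ⟨y, mem_sdiff_corridors_of_mem_sdiff_union y.2⟩ = π ⟨y', mem_sdiff_corridors_of_mem_sdiff_union y'.2⟩ then (0 : ℝ) else
        |A ⟨y, (Finset.mem_sdiff.mp y.2).1⟩ ⟨y', (Finset.mem_sdiff.mp y'.2).1⟩|) ≤
      J / (Real.cosh (κ * max (w : ℝ) (distToRegion (B.biUnion (box L)) y)) - 1) := by
  classical
  have hinj : Function.Injective (fun y' : ↥(Λ \ (C ∪ corridors L w B)) => (⟨y', mem_sdiff_corridors_of_mem_sdiff_union y'.2⟩ : ↥(Λ \ corridors L w B))) :=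
    fun y₁ y₂ h => Subtype.ext (by
      simpa using congrArg (fun z : ↥(Λ \ corridors L w B) => (z : B1Eq324BenfattoLemma.Site d)) h)
  have hbig := cross_rowSum_le_of_class_pavement hκ hJ hL hw B π hπ ⟨y, mem_sdiff_corridors_of_mem_sdiff_union y.2⟩
  refine le_trans ?_ hbig
  have h1 : ∑ y' : ↥(Λ \ (C ∪ corridors L w B)), (if π ⟨y, mem_sdiff_corridors_of_mem_sdiff_union y.2⟩ = π ⟨y', mem_sdiff_corridors_of_mem_sdiff_union y'.2⟩ then (0 : ℝ) else
        |A ⟨y, (Finset.mem_sdiff.mp y.2).1⟩ ⟨y', (Finset.mem_sdiff.mp y'.2).1⟩|) =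
      ∑ z ∈ (Finset.univ : Finset ↥(Λ \ (C ∪ corridors L w B))).map ⟨_, hinj⟩,
        (if π ⟨y, mem_sdiff_corridors_of_mem_sdiff_union y.2⟩ = π z then (0 : ℝ) else
          |A ⟨y, (Finset.mem_sdiff.mp y.2).1⟩ ⟨z, (Finset.mem_sdiff.mp z.2).1⟩|) := by
    rw [Finset.sum_map]
    rfl
  rw [h1]
  exact Finset.sum_le_univ_sum_of_nonneg fun z => by
    split_ifs
    · exact le_rfl
    · exact abs_nonneg _

end Labels

section Step

variable {Λ : Finset (B1Eq324BenfattoLemma.Site d)} {A : Matrix Λ Λ ℝ}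
  {K : B1Eq324BenfattoLemma.Site d → B1Eq324BenfattoLemma.Site d → ℝ}
  (hK : ∀ x y, K x y = if h : x ∈ Λ ∧ y ∈ Λ then (A⁻¹ : Matrix Λ Λ ℝ) ⟨x, h.1⟩ ⟨y, h.2⟩ else 0)
  {s D : ℕ} {κ : ℝ} {a : Coef d} {J I : Finset (B1Eq324BenfattoLemma.Site d)} {L w v : ℕ} {B C : Finset (B1Eq324BenfattoLemma.Site d)} {γ b Ac : ℝ}

include hK

/-- **Under `P̄^K_{C,z̄}` the (4.6)-integral VANISHES when `z̄` is not small on `C`** (`C ⊆ Λ`, `A` positive definite): `P̄^K_{C,z̄}`-a.s. the field IS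
`z̄` on `C` (`…KernelCondField.condFieldK_ae_eqOn`), so the small-field cut-off fails («then assuming |z_Δ| ≦ b(1+d(Δ,I)), ∀Δ ∈ C», p. 159 — the
other case is empty).  The free-field statement is `…Sect5UpperStep.integral_cutoffBoltzmann_condField_eq_zero_of_not_mem`.
[cite: BenfattoEtAl1978, §5 p.159, (4.6) p.152 (class form)] -/
theorem integral_cutoffBoltzmann_condFieldK_eq_zero_of_not_mem (hA : A.PosDef) (hCΛ : C ⊆ Λ) (zbar : B1Eq324BenfattoLemma.Site d → ℝ)
    (H : (B1Eq324BenfattoLemma.Site d → ℝ) → ℝ) (I : Finset (B1Eq324BenfattoLemma.Site d)) {c : ℝ} (hz : zbar ∉ smallFieldOn (C : Set (B1Eq324BenfattoLemma.Site d)) I c) :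
    ∫ z, cutoffBoltzmann H I c z ∂((gaussianFieldOfKernel (condCov K C)).map
        fun (ζ : B1Eq324BenfattoLemma.Site d → ℝ) (x : B1Eq324BenfattoLemma.Site d) => condMean K C zbar x + ζ x) = 0 := by
  have hae : ∀ᵐ z ∂((gaussianFieldOfKernel (condCov K C)).map
      fun (ζ : B1Eq324BenfattoLemma.Site d → ℝ) (x : B1Eq324BenfattoLemma.Site d) => condMean K C zbar x + ζ x), cutoffBoltzmann H I c z = 0 := by
    filter_upwards [condFieldK_ae_eqOn (isPosSemidefKernel_kernel hK hA) C (isUnit_det_covGram_kernel hK hA hCΛ) zbar] with z hzC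
    have hz' : z ∉ smallFieldSet I c := by
      intro hmem
      apply hz
      intro x hx
      rw [← hzC x (Finset.mem_coe.mp hx)]
      exact hmem x
    simp only [cutoffBoltzmann, Set.indicator_of_notMem hz']
  rw [integral_congr_ae hae, integral_zero]

/-- **THE UPPER PAVEMENT STEP UNDER `P̄^K_{C,z̄}` FOR THE CLASS, THE ANALYTIC ROWS DISCHARGED FROM THE CLASS CONSTANTS** —
`…KernelSect5UpperStep.upperPavementStep_cond_of_setIntegral` with `r_y := J_c/(cosh(θ·max(w, d(Δ_y, ∪B))) − 1)` over `y ∈ Λ − (C ∪ Γ₁)`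
(`cross_rowSum_union_le_of_class_pavement`, labelling from `…KernelSect5ClassRows.exists_labels`), `r_max := J_c/(cosh θw − 1)`, `C_u := VM/(γ_A − J_c)`
(`abs_condMean_union_le_of_classRows`: the datum is `γb`-small on `Γ₁` and `b`-small on `C`), `T := (1+C_u)²b²Σ_y r_y(1+d(I,y))²`, the far kernel
constructed inside.  Hypotheses: the frame-0 class constants `(γ_A, θ, J_c, V, M)` and the guard `J_c/(cosh θw − 1) < γ_A`; `A` supported in `J ⊆ I` with the
global bound `|A| ≤ A_c`; print's pavement (`L ≥ 1`, `0 < w`, `v ≤ w`, `B ⊇` the tesserae meeting `J`) with `C`, `Γ₁` and the boxes inside `Λ`; the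
definitional part-kernel row (parts `shrink L m w − C`); `γ ≤ 1 ≤ b`, `1 ≤ γb`; `z̄` small on `C`; per-box UPPER bounds in part-field currency:
`∫Π_Δχ̂^{γb}_Δ e^{H^A_J} dP̄^K_{C,z̄} ≤ exp(err₅₁₁(γb) + err₅₃₄(b) + 2(ρ′ + T/2) + Σ_{□∈B}u_□)·∫Π_Δχ̂^{b}_Δ e^{H^{A|Γ̄₁}_{J∩Γ̄₁}} dP̄^K_{C,z̄}`.
[cite: BenfattoEtAl1978, §5 (5.36) p.159, (4.6) p.152; Balaban1985BackgroundPropagators, (1.16)–(1.18) p.180 (class substitute at temperature zero; ours)] -/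
theorem upperPavementStep_of_classRows
    (hAs : ∀ e e', A e e' = A e' e) {γA : ℝ} (hγA0 : 0 < γA)
    (hγA : ∀ x : Λ → ℝ, γA * ∑ e, x e ^ 2 ≤ ∑ e, ∑ e', A e e' * x e * x e')
    {θ Jc V M : ℝ} (hθ : 0 < θ)
    (hJc : ∀ e : Λ, ∑ e' : Λ, |A e e'| * (Real.cosh (θ * Real.sqrt (∑ j, ((((e : B1Eq324BenfattoLemma.Site d) j : ℝ) - ((e' : B1Eq324BenfattoLemma.Site d) j : ℝ))) ^ 2)) - 1) ≤ Jc)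
    (hJcγ : Jc < γA)
    (hV : ∀ e : Λ, ∑ e' : Λ, Real.exp (-(θ * Real.sqrt (∑ j, ((((e : B1Eq324BenfattoLemma.Site d) j : ℝ) - ((e' : B1Eq324BenfattoLemma.Site d) j : ℝ))) ^ 2))) *
      (1 + Real.sqrt (∑ j, ((((e : B1Eq324BenfattoLemma.Site d) j : ℝ) - ((e' : B1Eq324BenfattoLemma.Site d) j : ℝ))) ^ 2)) ≤ V)
    (hM : ∀ e : Λ, ∑ e' : Λ, |A e e'| * (1 + Real.sqrt (∑ j, ((((e : B1Eq324BenfattoLemma.Site d) j : ℝ) - ((e' : B1Eq324BenfattoLemma.Site d) j : ℝ))) ^ 2)) ≤ M)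
    (hguard : Jc / (Real.cosh (θ * w) - 1) < γA)
    (hκ : 0 < κ) (hJ : CoefSupportedIn a J) (hAc0 : 0 ≤ Ac)
    (hAc : ∀ (p : ℕ) (Δ : Fin p → B1Eq324BenfattoLemma.Site d) (n : Fin p → ℕ), |a p Δ n| ≤ Ac)
    (hJI : J ⊆ I) (hL : 0 < L) (hw : 0 < w) (hv : v ≤ w) (hγ1 : γ ≤ 1) (hb : 1 ≤ b) (hγb : 1 ≤ γ * b)
    (hCΛ : C ⊆ Λ) (hΓΛ : corridors L w B ⊆ Λ) (hBΛ : ∀ m ∈ B, box L m ⊆ Λ) (hB : J.image (boxIndex L) ⊆ B)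
    {Kb : B1Eq324BenfattoLemma.Site d → B1Eq324BenfattoLemma.Site d → B1Eq324BenfattoLemma.Site d → ℝ}
    (hKb : ∀ m (hm : m ∈ B) x y, Kb m x y = if h : x ∈ shrink L m w \ C ∧ y ∈ shrink L m w \ C then
      ((A.submatrix (fun j : ↥(shrink L m w \ C) => (⟨j, hBΛ m hm (shrink_subset_box L m w (Finset.mem_sdiff.mp j.2).1)⟩ : Λ))
        (fun j : ↥(shrink L m w \ C) => (⟨j, hBΛ m hm (shrink_subset_box L m w (Finset.mem_sdiff.mp j.2).1)⟩ : Λ)))⁻¹ :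
          Matrix ↥(shrink L m w \ C) ↥(shrink L m w \ C) ℝ) ⟨x, h.1⟩ ⟨y, h.2⟩ else 0)
    (zbar : B1Eq324BenfattoLemma.Site d → ℝ) (hzbar : zbar ∈ smallFieldOn (C : Set (B1Eq324BenfattoLemma.Site d)) I b) (u : B1Eq324BenfattoLemma.Site d → ℝ)
    (hbox : ∀ m ∈ B, ∀ ξ : B1Eq324BenfattoLemma.Site d → ℝ, ξ ∈ smallFieldOn (corridors L w B : Set (B1Eq324BenfattoLemma.Site d)) I (γ * b) →
      ξ ∈ smallFieldOn (C : Set (B1Eq324BenfattoLemma.Site d)) I b →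
      ∫ z in smallFieldOn (shrink L m w : Set (B1Eq324BenfattoLemma.Site d)) I b, Real.exp (psiBox s D κ a L w m z) ∂((gaussianFieldOfKernel (Kb m)).map
              fun (ζ : B1Eq324BenfattoLemma.Site d → ℝ) (x : B1Eq324BenfattoLemma.Site d) => condMean K (C ∪ corridors L w B) ξ x + ζ x)
        ≤ Real.exp (u m) * ∫ z in smallFieldOn (shrink L m w : Set (B1Eq324BenfattoLemma.Site d)) I b,
          Real.exp (psi1p s D κ a L w v m z + psi2 s D κ a L w m z) ∂((gaussianFieldOfKernel (Kb m)).map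
              fun (ζ : B1Eq324BenfattoLemma.Site d → ℝ) (x : B1Eq324BenfattoLemma.Site d) => condMean K (C ∪ corridors L w B) ξ x + ζ x)) :
    ∫ z, cutoffBoltzmann (hamiltonian s D κ a J) I (γ * b) z ∂((gaussianFieldOfKernel (condCov K C)).map
          fun (ζ : B1Eq324BenfattoLemma.Site d → ℝ) (x : B1Eq324BenfattoLemma.Site d) => condMean K C zbar x + ζ x) ≤
      Real.exp (s1Const s D d κ * Ac * (γ * b) ^ D * Real.exp (-(κ / 4 * w)) * J.card
        + s1Const s D d κ * Ac * b ^ D *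
          (Real.exp (-(κ / 4 * w)) * (corridorsBar L w v B).card + Real.exp (-(κ / 4 * v)) * (B.card * (L : ℝ) ^ d))
        + 2 * ((∑ y : ↥(Λ \ (C ∪ corridors L w B)), Jc / (Real.cosh (θ * max (w : ℝ) (distToRegion (B.biUnion (box L)) y)) - 1)) / (γA - Jc / (Real.cosh (θ * w) - 1)) +
          ((1 + V * M / (γA - Jc)) ^ 2 * b ^ 2 *
          ∑ y : ↥(Λ \ (C ∪ corridors L w B)), Jc / (Real.cosh (θ * max (w : ℝ) (distToRegion (B.biUnion (box L)) y)) - 1) * (1 + distToRegion I y) ^ 2) / 2)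
        + ∑ m ∈ B, u m) *
        ∫ z, cutoffBoltzmann (hamiltonian s D κ (restrictCoef a (corridorsBar L w v B)) (J ∩ corridorsBar L w v B)) I b z ∂((gaussianFieldOfKernel (condCov K C)).map
          fun (ζ : B1Eq324BenfattoLemma.Site d → ℝ) (x : B1Eq324BenfattoLemma.Site d) => condMean K C zbar x + ζ x) := by
  classical
  have hJc0 : ∀ y : ↥(Λ \ (C ∪ corridors L w B)), 0 ≤ Jc := fun y =>
    le_trans (Finset.sum_nonneg fun e' _ => mul_nonneg (abs_nonneg _) (sub_nonneg.mpr (Real.one_le_cosh _)))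
      (hJc ⟨y, (Finset.mem_sdiff.mp y.2).1⟩)
  have hJcube := fun e => rowDefect_cubeDist_le_of_rowDefect_sqrt hθ.le hJc e
  -- the labelling of `Λ − Γ₁`, restricted to `Λ − (C ∪ Γ₁)`
  obtain ⟨π, hπ⟩ := exists_labels (Λ := Λ) (w := w) hL B
  have hr := fun y : ↥(Λ \ (C ∪ corridors L w B)) => cross_rowSum_union_le_of_class_pavement hθ hJcube hL hw B C π hπ y
  have hrmax : ∀ y : ↥(Λ \ (C ∪ corridors L w B)),
      (fun y : ↥(Λ \ (C ∪ corridors L w B)) => Jc / (Real.cosh (θ * max (w : ℝ) (distToRegion (B.biUnion (box L)) y)) - 1)) y ≤ Jc / (Real.cosh (θ * w) - 1) :=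
    fun y => crossRow_le_rmax hθ (hJc0 y) hw
  exact upperPavementStep_cond_of_setIntegral hK hAs hγA0 hγA hJI hL hγ1 hb (Finset.union_subset hCΛ hΓΛ) hBΛ
    (fun y : ↥(Λ \ (C ∪ corridors L w B)) => π ⟨y, mem_sdiff_corridors_of_mem_sdiff_union y.2⟩)
    (fun y m => hπ ⟨y, mem_sdiff_corridors_of_mem_sdiff_union y.2⟩ m)
    (fun y : ↥(Λ \ (C ∪ corridors L w B)) => Jc / (Real.cosh (θ * max (w : ℝ) (distToRegion (B.biUnion (box L)) y)) - 1)) hr hrmax hguard hKb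
    (fun _ _ => rfl) (abs_condMean_union_le_of_classRows hK hAs hγA0 hγA hθ.le hJc hJcγ hV hM hγ1 hb hCΛ hΓΛ) le_rfl
    hκ hJ hAc0 (fun p _ Δ _ n _ => hAc p Δ n) hv hB hγb zbar hzbar u hbox

/-- **THE SAME, FOR ANY CONDITIONING VALUES `z̄`** — if `z̄` is not `b`-small on `C` it is not `γb`-small either (`γ ≤ 1`), the left side vanishes
(`integral_cutoffBoltzmann_condFieldK_eq_zero_of_not_mem`) and the right side is non-negative; otherwise `upperPavementStep_of_classRows`.  This is the
shape the chain iterates (no smallness bookkeeping for the drifting conditioning datum).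
[cite: BenfattoEtAl1978, §5 (5.36) p.159 «then assuming |z_Δ| ≦ b(1+d(Δ,I)), ∀Δ ∈ C», (4.6) p.152 (class form; ours)] -/
theorem upperPavementStep_of_classRows'
    (hAs : ∀ e e', A e e' = A e' e) {γA : ℝ} (hγA0 : 0 < γA)
    (hγA : ∀ x : Λ → ℝ, γA * ∑ e, x e ^ 2 ≤ ∑ e, ∑ e', A e e' * x e * x e')
    {θ Jc V M : ℝ} (hθ : 0 < θ)
    (hJc : ∀ e : Λ, ∑ e' : Λ, |A e e'| * (Real.cosh (θ * Real.sqrt (∑ j, ((((e : B1Eq324BenfattoLemma.Site d) j : ℝ) - ((e' : B1Eq324BenfattoLemma.Site d) j : ℝ))) ^ 2)) - 1) ≤ Jc)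
    (hJcγ : Jc < γA)
    (hV : ∀ e : Λ, ∑ e' : Λ, Real.exp (-(θ * Real.sqrt (∑ j, ((((e : B1Eq324BenfattoLemma.Site d) j : ℝ) - ((e' : B1Eq324BenfattoLemma.Site d) j : ℝ))) ^ 2))) *
      (1 + Real.sqrt (∑ j, ((((e : B1Eq324BenfattoLemma.Site d) j : ℝ) - ((e' : B1Eq324BenfattoLemma.Site d) j : ℝ))) ^ 2)) ≤ V)
    (hM : ∀ e : Λ, ∑ e' : Λ, |A e e'| * (1 + Real.sqrt (∑ j, ((((e : B1Eq324BenfattoLemma.Site d) j : ℝ) - ((e' : B1Eq324BenfattoLemma.Site d) j : ℝ))) ^ 2)) ≤ M)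
    (hguard : Jc / (Real.cosh (θ * w) - 1) < γA)
    (hκ : 0 < κ) (hJ : CoefSupportedIn a J) (hAc0 : 0 ≤ Ac)
    (hAc : ∀ (p : ℕ) (Δ : Fin p → B1Eq324BenfattoLemma.Site d) (n : Fin p → ℕ), |a p Δ n| ≤ Ac)
    (hJI : J ⊆ I) (hL : 0 < L) (hw : 0 < w) (hv : v ≤ w) (hγ1 : γ ≤ 1) (hb : 1 ≤ b) (hγb : 1 ≤ γ * b)
    (hCΛ : C ⊆ Λ) (hΓΛ : corridors L w B ⊆ Λ) (hBΛ : ∀ m ∈ B, box L m ⊆ Λ) (hB : J.image (boxIndex L) ⊆ B)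
    {Kb : B1Eq324BenfattoLemma.Site d → B1Eq324BenfattoLemma.Site d → B1Eq324BenfattoLemma.Site d → ℝ}
    (hKb : ∀ m (hm : m ∈ B) x y, Kb m x y = if h : x ∈ shrink L m w \ C ∧ y ∈ shrink L m w \ C then
      ((A.submatrix (fun j : ↥(shrink L m w \ C) => (⟨j, hBΛ m hm (shrink_subset_box L m w (Finset.mem_sdiff.mp j.2).1)⟩ : Λ))
        (fun j : ↥(shrink L m w \ C) => (⟨j, hBΛ m hm (shrink_subset_box L m w (Finset.mem_sdiff.mp j.2).1)⟩ : Λ)))⁻¹ :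
          Matrix ↥(shrink L m w \ C) ↥(shrink L m w \ C) ℝ) ⟨x, h.1⟩ ⟨y, h.2⟩ else 0)
    (zbar : B1Eq324BenfattoLemma.Site d → ℝ) (u : B1Eq324BenfattoLemma.Site d → ℝ)
    (hbox : ∀ m ∈ B, ∀ ξ : B1Eq324BenfattoLemma.Site d → ℝ, ξ ∈ smallFieldOn (corridors L w B : Set (B1Eq324BenfattoLemma.Site d)) I (γ * b) →
      ξ ∈ smallFieldOn (C : Set (B1Eq324BenfattoLemma.Site d)) I b →
      ∫ z in smallFieldOn (shrink L m w : Set (B1Eq324BenfattoLemma.Site d)) I b, Real.exp (psiBox s D κ a L w m z) ∂((gaussianFieldOfKernel (Kb m)).map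
              fun (ζ : B1Eq324BenfattoLemma.Site d → ℝ) (x : B1Eq324BenfattoLemma.Site d) => condMean K (C ∪ corridors L w B) ξ x + ζ x)
        ≤ Real.exp (u m) * ∫ z in smallFieldOn (shrink L m w : Set (B1Eq324BenfattoLemma.Site d)) I b,
          Real.exp (psi1p s D κ a L w v m z + psi2 s D κ a L w m z) ∂((gaussianFieldOfKernel (Kb m)).map
              fun (ζ : B1Eq324BenfattoLemma.Site d → ℝ) (x : B1Eq324BenfattoLemma.Site d) => condMean K (C ∪ corridors L w B) ξ x + ζ x)) :
    ∫ z, cutoffBoltzmann (hamiltonian s D κ a J) I (γ * b) z ∂((gaussianFieldOfKernel (condCov K C)).map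
          fun (ζ : B1Eq324BenfattoLemma.Site d → ℝ) (x : B1Eq324BenfattoLemma.Site d) => condMean K C zbar x + ζ x) ≤
      Real.exp (s1Const s D d κ * Ac * (γ * b) ^ D * Real.exp (-(κ / 4 * w)) * J.card
        + s1Const s D d κ * Ac * b ^ D *
          (Real.exp (-(κ / 4 * w)) * (corridorsBar L w v B).card + Real.exp (-(κ / 4 * v)) * (B.card * (L : ℝ) ^ d))
        + 2 * ((∑ y : ↥(Λ \ (C ∪ corridors L w B)), Jc / (Real.cosh (θ * max (w : ℝ) (distToRegion (B.biUnion (box L)) y)) - 1)) / (γA - Jc / (Real.cosh (θ * w) - 1)) +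
          ((1 + V * M / (γA - Jc)) ^ 2 * b ^ 2 *
          ∑ y : ↥(Λ \ (C ∪ corridors L w B)), Jc / (Real.cosh (θ * max (w : ℝ) (distToRegion (B.biUnion (box L)) y)) - 1) * (1 + distToRegion I y) ^ 2) / 2)
        + ∑ m ∈ B, u m) *
        ∫ z, cutoffBoltzmann (hamiltonian s D κ (restrictCoef a (corridorsBar L w v B)) (J ∩ corridorsBar L w v B)) I b z ∂((gaussianFieldOfKernel (condCov K C)).map
          fun (ζ : B1Eq324BenfattoLemma.Site d → ℝ) (x : B1Eq324BenfattoLemma.Site d) => condMean K C zbar x + ζ x) := by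
  by_cases hz : zbar ∈ smallFieldOn (C : Set (B1Eq324BenfattoLemma.Site d)) I b
  · exact upperPavementStep_of_classRows hK hAs hγA0 hγA hθ hJc hJcγ hV hM hguard hκ hJ hAc0 hAc hJI hL hw hv hγ1 hb hγb hCΛ hΓΛ hBΛ hB hKb
      zbar hz u hbox
  · have hz' : zbar ∉ smallFieldOn (C : Set (B1Eq324BenfattoLemma.Site d)) I (γ * b) := by
      intro h
      apply hz
      intro x hx
      have hb0 : 0 ≤ b := zero_le_one.trans hb
      have hd : 0 ≤ 1 + distToRegion I x := by
        have := distToRegion_nonneg I x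
        linarith
      calc |zbar x| ≤ γ * b * (1 + distToRegion I x) := h x hx
        _ ≤ b * (1 + distToRegion I x) := mul_le_mul_of_nonneg_right (by nlinarith) hd
    rw [integral_cutoffBoltzmann_condFieldK_eq_zero_of_not_mem hK (posDef_of_coercive hAs hγA0 hγA) hCΛ zbar _ I hz']
    exact mul_nonneg (Real.exp_pos _).le (integral_cutoffBoltzmann_nonneg _ _ I b)

end Step

/-! ## §2  The (4.6)-integral in a drifting frame: datum AND conditioning datum translated -/

section Frames

variable {G : B1Eq324BenfattoLemma.Site d → B1Eq324BenfattoLemma.Site d → ℝ} {s D : ℕ} {κ : ℝ} {a : Coef d}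

/-- **THE (4.6)-INTEGRAL IN A DRIFTING FRAME, FOR ANY KERNEL**: `∫Π_Δχ̂^I_b e^{H^A_J} dP̄^{G(·+τ,·+τ)}_{C,ζ} = ∫Π_Δχ̂^{I+τ}_b e^{H^{A(·−τ)}_{J+τ}} dP̄^G_{C+τ,ζ(·−τ)}`
(`G` positive semidefinite, `G_{(C+τ)(C+τ)}` invertible) — `…KernelCondTranslation.integral_condFieldK_comp_translate` read in the assembler's direction with
`…Sect5PavementChain.cutoffBoltzmann_frame`; the free-field statement is `…Sect5PavementChainUpper.integral_cutoffBoltzmann_condField_frame`.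
[cite: BenfattoEtAl1978, p.152 «P̂₀(dz|(z̄_Δ)_{Δ∈C})», §5 p.159 «a new pavement displaced» (class form; ours)] -/
theorem integral_cutoffBoltzmann_condFieldK_frame (hG : IsPosSemidefKernel G) (J I C : Finset (B1Eq324BenfattoLemma.Site d)) (ζ : B1Eq324BenfattoLemma.Site d → ℝ) (b : ℝ)
    (τ : B1Eq324BenfattoLemma.Site d) (hC : IsUnit (covGram G (C.image fun x => x + τ)).det) :
    ∫ z, cutoffBoltzmann (hamiltonian s D κ a J) I b z ∂((gaussianFieldOfKernel (condCov (fun x y => G (x + τ) (y + τ)) (C))).map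
          fun (ζ' : B1Eq324BenfattoLemma.Site d → ℝ) (x : B1Eq324BenfattoLemma.Site d) => condMean (fun x y => G (x + τ) (y + τ)) (C) (ζ) x + ζ' x) =
      ∫ z, cutoffBoltzmann (hamiltonian s D κ (shiftCoef a (-τ)) (J.image fun x => x + τ)) (I.image fun x => x + τ) b z
        ∂((gaussianFieldOfKernel (condCov (G) (C.image fun x => x + τ))).map
          fun (ζ' : B1Eq324BenfattoLemma.Site d → ℝ) (x : B1Eq324BenfattoLemma.Site d) => condMean (G) (C.image fun x => x + τ) (fun y => ζ (y - τ)) x + ζ' x) := by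
  have h := integral_condFieldK_comp_translate G hG C τ hC (fun y => ζ (y - τ))
    (measurable_cutoffBoltzmann_hamiltonian (s := s) (D := D) (κ := κ) a J I b)
  simp only [add_sub_cancel_right] at h
  rw [← h]
  exact integral_congr_ae (ae_of_all _ fun z => (cutoffBoltzmann_frame J I b τ z).symm)

end Frames

/-! ## §3  One displaced class upper step -/

section FrameStep

variable {Λ : Finset (B1Eq324BenfattoLemma.Site d)} {A : Matrix Λ Λ ℝ}
  {K : B1Eq324BenfattoLemma.Site d → B1Eq324BenfattoLemma.Site d → ℝ}
  (hK : ∀ x y, K x y = if h : x ∈ Λ ∧ y ∈ Λ then (A⁻¹ : Matrix Λ Λ ℝ) ⟨x, h.1⟩ ⟨y, h.2⟩ else 0)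
  {s D : ℕ} {κ : ℝ} {L w v : ℕ} {γ Ac : ℝ}

include hK

/-- **ONE DISPLACED CLASS UPPER STEP** — `upperPavementStep_of_classRows'` for the class member in frame `σ` (`(Λ − σ, A(·+σ,·+σ))`, class kernel
`K(·+σ,·+σ)`) applied to the datum `(A(·−τ), J+τ, I+τ)` and the conditioning datum `(C+τ, ζ(·−τ))`, read back under `P̄^{K(·+(τ+σ),·+(τ+σ))}_{C,ζ}` by
`integral_cutoffBoltzmann_condFieldK_frame`: displayed are the frame-0 class constants and guard (frame invariant), the Hamiltonian data with the global
bound, `C + τ`, `Γ₁` and the boxes inside `Λ − σ`, the definitional part-kernel row (parts `shrink L m w − (C+τ)`), `γ ≤ 1 ≤ b`, `1 ≤ γb`, and per-box UPPER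
bounds for the translated datum; ANY conditioning values `ζ`.
`∫Π_Δχ̂^{I}_{γb}e^{H^A_J}dP̄^{K(·+(τ+σ))}_{C,ζ} ≤ exp(err₅₁₁(γb) + err₅₃₄(b) + 2(ρ′ + T/2) + Σ_{□∈B}u_□)·∫Π_Δχ̂^{I+τ}_{b}e^{H^{(A(·−τ))|Γ̄₁}_{(J+τ)∩Γ̄₁}}dP̄^{K(·+σ)}_{C+τ,ζ(·−τ)}`.
[cite: BenfattoEtAl1978, §5 (5.36) p.159, (4.6) p.152, p.159 «displaced»; Balaban1985BackgroundPropagators, (1.16)–(1.18) p.180 (class form; ours)] -/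
theorem upperPavementStep_of_classRows_frame
    (hAs : ∀ e e', A e e' = A e' e) {γA : ℝ} (hγA0 : 0 < γA)
    (hγA : ∀ x : Λ → ℝ, γA * ∑ e, x e ^ 2 ≤ ∑ e, ∑ e', A e e' * x e * x e')
    {θ Jc V M : ℝ} (hθ : 0 < θ)
    (hJc : ∀ e : Λ, ∑ e' : Λ, |A e e'| * (Real.cosh (θ * Real.sqrt (∑ j, ((((e : B1Eq324BenfattoLemma.Site d) j : ℝ) - ((e' : B1Eq324BenfattoLemma.Site d) j : ℝ))) ^ 2)) - 1) ≤ Jc)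
    (hJcγ : Jc < γA)
    (hV : ∀ e : Λ, ∑ e' : Λ, Real.exp (-(θ * Real.sqrt (∑ j, ((((e : B1Eq324BenfattoLemma.Site d) j : ℝ) - ((e' : B1Eq324BenfattoLemma.Site d) j : ℝ))) ^ 2))) *
      (1 + Real.sqrt (∑ j, ((((e : B1Eq324BenfattoLemma.Site d) j : ℝ) - ((e' : B1Eq324BenfattoLemma.Site d) j : ℝ))) ^ 2)) ≤ V)
    (hM : ∀ e : Λ, ∑ e' : Λ, |A e e'| * (1 + Real.sqrt (∑ j, ((((e : B1Eq324BenfattoLemma.Site d) j : ℝ) - ((e' : B1Eq324BenfattoLemma.Site d) j : ℝ))) ^ 2)) ≤ M)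
    (hguard : Jc / (Real.cosh (θ * w) - 1) < γA)
    (hκ : 0 < κ) {a : Coef d} {J I : Finset (B1Eq324BenfattoLemma.Site d)} (hJ : CoefSupportedIn a J) (hAc0 : 0 ≤ Ac)
    (hAc : ∀ (p : ℕ) (Δ : Fin p → B1Eq324BenfattoLemma.Site d) (n : Fin p → ℕ), |a p Δ n| ≤ Ac)
    (hJI : J ⊆ I) (hL : 0 < L) (hw : 0 < w) (hv : v ≤ w) (hγ1 : γ ≤ 1) {b : ℝ} (hb : 1 ≤ b) (hγb : 1 ≤ γ * b)
    (σ τ : B1Eq324BenfattoLemma.Site d) {B C : Finset (B1Eq324BenfattoLemma.Site d)} (ζ : B1Eq324BenfattoLemma.Site d → ℝ)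
    (hCΛ : C.image (fun x => x + τ) ⊆ Λ.image fun y => y - σ) (hΓΛ : corridors L w B ⊆ Λ.image fun y => y - σ)
    (hBΛ : ∀ m ∈ B, box L m ⊆ Λ.image fun y => y - σ)
    (hB : (J.image fun x => x + τ).image (boxIndex L) ⊆ B)
    {Kb : B1Eq324BenfattoLemma.Site d → B1Eq324BenfattoLemma.Site d → B1Eq324BenfattoLemma.Site d → ℝ}
    (hKb : ∀ m (hm : m ∈ B) x y, Kb m x y =
      if h : x ∈ shrink L m w \ C.image (fun x => x + τ) ∧ y ∈ shrink L m w \ C.image (fun x => x + τ) then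
      (((A.submatrix (fun j : ↥(Λ.image fun y => y - σ) => (⟨(j : B1Eq324BenfattoLemma.Site d) + σ, (mem_image_sub_iff (σ)).mp j.2⟩ : Λ))
          (fun j : ↥(Λ.image fun y => y - σ) => (⟨(j : B1Eq324BenfattoLemma.Site d) + σ, (mem_image_sub_iff (σ)).mp j.2⟩ : Λ))).submatrix
          (fun j : ↥(shrink L m w \ C.image (fun x => x + τ)) =>
            (⟨j, hBΛ m hm (shrink_subset_box L m w (Finset.mem_sdiff.mp j.2).1)⟩ : ↥(Λ.image fun y => y - σ)))
          (fun j : ↥(shrink L m w \ C.image (fun x => x + τ)) =>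
            (⟨j, hBΛ m hm (shrink_subset_box L m w (Finset.mem_sdiff.mp j.2).1)⟩ : ↥(Λ.image fun y => y - σ))))⁻¹ :
          Matrix ↥(shrink L m w \ C.image (fun x => x + τ)) ↥(shrink L m w \ C.image (fun x => x + τ)) ℝ) ⟨x, h.1⟩ ⟨y, h.2⟩ else 0)
    (u : B1Eq324BenfattoLemma.Site d → ℝ)
    (hbox : ∀ m ∈ B, ∀ ξ : B1Eq324BenfattoLemma.Site d → ℝ,
      ξ ∈ smallFieldOn (corridors L w B : Set (B1Eq324BenfattoLemma.Site d)) (I.image fun x => x + τ) (γ * b) →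
      ξ ∈ smallFieldOn ((C.image fun x => x + τ : Finset (B1Eq324BenfattoLemma.Site d)) : Set (B1Eq324BenfattoLemma.Site d)) (I.image fun x => x + τ) b →
      ∫ z in smallFieldOn (shrink L m w : Set (B1Eq324BenfattoLemma.Site d)) (I.image fun x => x + τ) b,
          Real.exp (psiBox s D κ (shiftCoef a (-τ)) L w m z) ∂((gaussianFieldOfKernel (Kb m)).map
              fun (ζ' : B1Eq324BenfattoLemma.Site d → ℝ) (x : B1Eq324BenfattoLemma.Site d) =>
                condMean (fun x y => K (x + σ) (y + σ)) (C.image (fun x => x + τ) ∪ corridors L w B) ξ x + ζ' x)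
        ≤ Real.exp (u m) * ∫ z in smallFieldOn (shrink L m w : Set (B1Eq324BenfattoLemma.Site d)) (I.image fun x => x + τ) b,
          Real.exp (psi1p s D κ (shiftCoef a (-τ)) L w v m z + psi2 s D κ (shiftCoef a (-τ)) L w m z) ∂((gaussianFieldOfKernel (Kb m)).map
              fun (ζ' : B1Eq324BenfattoLemma.Site d → ℝ) (x : B1Eq324BenfattoLemma.Site d) =>
                condMean (fun x y => K (x + σ) (y + σ)) (C.image (fun x => x + τ) ∪ corridors L w B) ξ x + ζ' x)) :
    ∫ z, cutoffBoltzmann (hamiltonian s D κ a J) I (γ * b) z ∂((gaussianFieldOfKernel (condCov (fun x y => K (x + (τ + σ)) (y + (τ + σ))) (C))).map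
          fun (ζ' : B1Eq324BenfattoLemma.Site d → ℝ) (x : B1Eq324BenfattoLemma.Site d) => condMean (fun x y => K (x + (τ + σ)) (y + (τ + σ))) (C) (ζ) x + ζ' x) ≤
      Real.exp (s1Const s D d κ * Ac * (γ * b) ^ D * Real.exp (-(κ / 4 * w)) * J.card
        + s1Const s D d κ * Ac * b ^ D *
          (Real.exp (-(κ / 4 * w)) * (corridorsBar L w v B).card + Real.exp (-(κ / 4 * v)) * (B.card * (L : ℝ) ^ d))
        + 2 * ((∑ y : ↥((Λ.image fun y => y - σ) \ (C.image (fun x => x + τ) ∪ corridors L w B)),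
            Jc / (Real.cosh (θ * max (w : ℝ) (distToRegion (B.biUnion (box L)) y)) - 1)) / (γA - Jc / (Real.cosh (θ * w) - 1)) +
          ((1 + V * M / (γA - Jc)) ^ 2 * b ^ 2 *
          ∑ y : ↥((Λ.image fun y => y - σ) \ (C.image (fun x => x + τ) ∪ corridors L w B)),
            Jc / (Real.cosh (θ * max (w : ℝ) (distToRegion (B.biUnion (box L)) y)) - 1) *
              (1 + distToRegion (I.image fun x => x + τ) y) ^ 2) / 2)
        + ∑ m ∈ B, u m) *
        ∫ z, cutoffBoltzmann (hamiltonian s D κ (restrictCoef (shiftCoef a (-τ)) (corridorsBar L w v B))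
          ((J.image fun x => x + τ) ∩ corridorsBar L w v B)) (I.image fun x => x + τ) b z
          ∂((gaussianFieldOfKernel (condCov (fun x y => K (x + σ) (y + σ)) (C.image fun x => x + τ))).map
          fun (ζ' : B1Eq324BenfattoLemma.Site d → ℝ) (x : B1Eq324BenfattoLemma.Site d) => condMean (fun x y => K (x + σ) (y + σ)) (C.image fun x => x + τ) (fun y => ζ (y - τ)) x + ζ' x) := by
  classical
  -- the class member in frame `σ`
  have hKσ := kernel_translate σ hK
  have hAsσ := submatrix_translate_symm σ hAs
  have hγAσ := submatrix_translate_coercive σ hγA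
  have hl2 : ∀ x y : B1Eq324BenfattoLemma.Site d, Real.sqrt (∑ j, ((((x + σ) j : ℝ) - ((y + σ) j : ℝ))) ^ 2) = Real.sqrt (∑ j, (((x j : ℝ) - (y j : ℝ))) ^ 2) :=
    fun x y => l2_translate x y σ
  have hJcσ := submatrix_translate_row_le σ (A := A)
    (fun x y : B1Eq324BenfattoLemma.Site d => Real.cosh (θ * Real.sqrt (∑ j, (((x j : ℝ) - (y j : ℝ))) ^ 2)) - 1) (fun x y => by simp only [hl2]) hJc
  have hMσ := submatrix_translate_row_le σ (A := A)
    (fun x y : B1Eq324BenfattoLemma.Site d => 1 + Real.sqrt (∑ j, (((x j : ℝ) - (y j : ℝ))) ^ 2)) (fun x y => by simp only [hl2]) hM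
  have hVσ := translate_row_le σ (Λ := Λ)
    (fun x y : B1Eq324BenfattoLemma.Site d => Real.exp (-(θ * Real.sqrt (∑ j, (((x j : ℝ) - (y j : ℝ))) ^ 2))) *
      (1 + Real.sqrt (∑ j, (((x j : ℝ) - (y j : ℝ))) ^ 2))) (fun x y => by simp only [hl2]) hV
  -- the step in frame `σ`, any conditioning values
  have hstep := upperPavementStep_of_classRows' hKσ hAsσ hγA0 hγAσ hθ hJcσ hJcγ hVσ hMσ hguard hκ (coefSupportedIn_frame hJ τ) hAc0
    (fun p Δ n => abs_shiftCoef_neg_le hAc τ p Δ n) (Finset.image_subset_image hJI) hL hw hv hγ1 hb hγb hCΛ hΓΛ hBΛ hB hKb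
    (fun y => ζ (y - τ)) u hbox
  have hcard : ((J.image fun x => x + τ).card : ℝ) = J.card := by
    rw [Finset.card_image_of_injective _ (add_left_injective τ)]
  rw [hcard] at hstep
  -- read the left side back in frame `τ + σ`
  have hApdσ := posDef_of_coercive hAsσ hγA0 hγAσ
  have hG : IsPosSemidefKernel (fun x y => K (x + σ) (y + σ)) := isPosSemidefKernel_kernel hKσ hApdσ
  have hframe := integral_cutoffBoltzmann_condFieldK_frame (G := fun x y => K (x + σ) (y + σ)) (s := s) (D := D) (κ := κ) (a := a) hG J I C ζ
    (γ * b) τ (isUnit_det_covGram_kernel hKσ hApdσ hCΛ)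
  have hKeq : (fun x y : B1Eq324BenfattoLemma.Site d => K (x + (τ + σ)) (y + (τ + σ))) = fun x y => K (x + τ + σ) (y + τ + σ) := by
    funext x y
    rw [add_assoc, add_assoc]
  rw [hKeq, hframe]
  exact hstep

end FrameStep

/-! ## §4  The upper chain for the class: `n` displaced steps, drifting conditioning datum, growing cut-offs -/

section Chain

variable {Λ : Finset (B1Eq324BenfattoLemma.Site d)} {A : Matrix Λ Λ ℝ}
  {K : B1Eq324BenfattoLemma.Site d → B1Eq324BenfattoLemma.Site d → ℝ}
  (hK : ∀ x y, K x y = if h : x ∈ Λ ∧ y ∈ Λ then (A⁻¹ : Matrix Λ Λ ℝ) ⟨x, h.1⟩ ⟨y, h.2⟩ else 0)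
  {s D : ℕ} {κ : ℝ} {L w v : ℕ} {γ Ac : ℝ}

include hK

/-- **THE (4.6) CHAIN FOR THE CLASS — `n` DISPLACED UPPER STEPS UNDER `P̄^K`** (the class twin of `…Sect5PavementChainUpper.upperPavementChainCond`):
for the frame-0 class constants of `(Λ, A)` and ANY sequences `J_k ⊆ I_k`, `B_k`, `A_k`, conditioning data `(C_k, z̄_k)`, box cut-offs `b_k`,
displacements `τ_k` and kernel offsets `σ_k` obeying `J_{k+1} = (J_k + τ_k) ∩ Γ̄₁(B_k)`, `I_{k+1} = I_k + τ_k`, `A_{k+1} = (A_k(·−τ_k))|_{Γ̄₁(B_k)}`,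
`C_{k+1} = C_k + τ_k`, `z̄_{k+1} = z̄_k∘(·−τ_k)`, `γb_{k+1} = b_k`, `σ_0 = 0`, `σ_{k+1} = σ_k − τ_k` (hypotheses), with `A_0` supported in `J_0` and globally
bounded by `A_c ≥ 0`, `B_k ⊇` the tesserae meeting `J_k + τ_k`, `1 ≤ b_k`, `1 ≤ γb_k`, the step-`k` conditioning set, corridors and boxes inside the
frame-`σ_{k+1}` region, the definitional part-kernel rows, and per-box UPPER bounds `u_k(□)` in part-field currency:
`∫Π_Δχ̂^{I_0}_{γb_0}e^{H^{A_0}_{J_0}}dP̄^K_{C_0,z̄_0} ≤ exp(Σ_{k<n}(err₅₁₁(k) + err₅₃₄(k) + 2P′_k + Σ_{□∈B_k}u_k(□)))·∫Π_Δχ̂^{I_n}_{γb_n}e^{H^{A_n}_{J_n}}dP̄^{K(·+σ_n,·+σ_n)}_{C_n,z̄_n}`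
(`upperPavementStep_of_classRows_frame` chained by `…Sect5PavementChain.le_exp_sum_mul_of_steps`, the invariants by `chain_invariants`).
[cite: BenfattoEtAl1978, §5 (5.36) p.159, (4.6) p.152; Balaban1985BackgroundPropagators, (1.16)–(1.18) p.180 (class form; ours)] -/
theorem upperPavementChainCond
    (hAs : ∀ e e', A e e' = A e' e) {γA : ℝ} (hγA0 : 0 < γA)
    (hγA : ∀ x : Λ → ℝ, γA * ∑ e, x e ^ 2 ≤ ∑ e, ∑ e', A e e' * x e * x e')
    {θ Jc V M : ℝ} (hθ : 0 < θ)
    (hJc : ∀ e : Λ, ∑ e' : Λ, |A e e'| * (Real.cosh (θ * Real.sqrt (∑ j, ((((e : B1Eq324BenfattoLemma.Site d) j : ℝ) - ((e' : B1Eq324BenfattoLemma.Site d) j : ℝ))) ^ 2)) - 1) ≤ Jc)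
    (hJcγ : Jc < γA)
    (hV : ∀ e : Λ, ∑ e' : Λ, Real.exp (-(θ * Real.sqrt (∑ j, ((((e : B1Eq324BenfattoLemma.Site d) j : ℝ) - ((e' : B1Eq324BenfattoLemma.Site d) j : ℝ))) ^ 2))) *
      (1 + Real.sqrt (∑ j, ((((e : B1Eq324BenfattoLemma.Site d) j : ℝ) - ((e' : B1Eq324BenfattoLemma.Site d) j : ℝ))) ^ 2)) ≤ V)
    (hM : ∀ e : Λ, ∑ e' : Λ, |A e e'| * (1 + Real.sqrt (∑ j, ((((e : B1Eq324BenfattoLemma.Site d) j : ℝ) - ((e' : B1Eq324BenfattoLemma.Site d) j : ℝ))) ^ 2)) ≤ M)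
    (hguard : Jc / (Real.cosh (θ * w) - 1) < γA)
    (hκ : 0 < κ) (hL : 0 < L) (hw : 0 < w) (hv : v ≤ w) (hγ1 : γ ≤ 1) (hAc0 : 0 ≤ Ac) {n : ℕ}
    {Js Is Bs Cs : ℕ → Finset (B1Eq324BenfattoLemma.Site d)} {as : ℕ → Coef d} {zs : ℕ → B1Eq324BenfattoLemma.Site d → ℝ} {bs : ℕ → ℝ}
    {τ σ : ℕ → B1Eq324BenfattoLemma.Site d}
    (hsupp : CoefSupportedIn (as 0) (Js 0))
    (hA : ∀ (p : ℕ) (Δ : Fin p → B1Eq324BenfattoLemma.Site d) (nn : Fin p → ℕ), |as 0 p Δ nn| ≤ Ac) (hJI : Js 0 ⊆ Is 0)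
    (hrecJ : ∀ k < n, Js (k + 1) = (Js k).image (fun x => x + τ k) ∩ corridorsBar L w v (Bs k))
    (hrecI : ∀ k < n, Is (k + 1) = (Is k).image fun x => x + τ k)
    (hreca : ∀ k < n, as (k + 1) = restrictCoef (shiftCoef (as k) (-τ k)) (corridorsBar L w v (Bs k)))
    (hrecC : ∀ k < n, Cs (k + 1) = (Cs k).image fun x => x + τ k)
    (hrecz : ∀ k < n, zs (k + 1) = fun y => zs k (y - τ k))
    (hrecb : ∀ k < n, γ * bs (k + 1) = bs k) (hb : ∀ k < n, 1 ≤ bs k) (hγb : ∀ k < n, 1 ≤ γ * bs k)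
    (hσ0 : σ 0 = 0) (hrecσ : ∀ k < n, σ (k + 1) = σ k - τ k)
    (hB : ∀ k < n, ((Js k).image fun x => x + τ k).image (boxIndex L) ⊆ Bs k)
    (hCΛ : ∀ k < n, (Cs k).image (fun x => x + τ k) ⊆ Λ.image fun y => y - σ (k + 1))
    (hΓΛ : ∀ k < n, corridors L w (Bs k) ⊆ Λ.image fun y => y - σ (k + 1))
    (hBΛ : ∀ k, k < n → ∀ m ∈ Bs k, box L m ⊆ Λ.image fun y => y - σ (k + 1))
    {Kbs : ℕ → B1Eq324BenfattoLemma.Site d → B1Eq324BenfattoLemma.Site d → B1Eq324BenfattoLemma.Site d → ℝ}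
    (hKbs : ∀ k (hk : k < n) m (hm : m ∈ Bs k) x y, Kbs k m x y =
      if h : x ∈ shrink L m w \ (Cs k).image (fun x => x + τ k) ∧ y ∈ shrink L m w \ (Cs k).image (fun x => x + τ k) then
      (((A.submatrix (fun j : ↥(Λ.image fun y => y - σ (k + 1)) => (⟨(j : B1Eq324BenfattoLemma.Site d) + σ (k + 1), (mem_image_sub_iff (σ (k + 1))).mp j.2⟩ : Λ))
          (fun j : ↥(Λ.image fun y => y - σ (k + 1)) => (⟨(j : B1Eq324BenfattoLemma.Site d) + σ (k + 1), (mem_image_sub_iff (σ (k + 1))).mp j.2⟩ : Λ))).submatrix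
          (fun j : ↥(shrink L m w \ (Cs k).image (fun x => x + τ k)) =>
            (⟨j, hBΛ k hk m hm (shrink_subset_box L m w (Finset.mem_sdiff.mp j.2).1)⟩ : ↥(Λ.image fun y => y - σ (k + 1))))
          (fun j : ↥(shrink L m w \ (Cs k).image (fun x => x + τ k)) =>
            (⟨j, hBΛ k hk m hm (shrink_subset_box L m w (Finset.mem_sdiff.mp j.2).1)⟩ : ↥(Λ.image fun y => y - σ (k + 1)))))⁻¹ :
          Matrix ↥(shrink L m w \ (Cs k).image (fun x => x + τ k)) ↥(shrink L m w \ (Cs k).image (fun x => x + τ k)) ℝ)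
            ⟨x, h.1⟩ ⟨y, h.2⟩ else 0)
    (u : ℕ → B1Eq324BenfattoLemma.Site d → ℝ)
    (hbox : ∀ k < n, ∀ m ∈ Bs k, ∀ ξ : B1Eq324BenfattoLemma.Site d → ℝ,
      ξ ∈ smallFieldOn (corridors L w (Bs k) : Set (B1Eq324BenfattoLemma.Site d)) ((Is k).image fun x => x + τ k) (γ * bs k) →
      ξ ∈ smallFieldOn (((Cs k).image fun x => x + τ k : Finset (B1Eq324BenfattoLemma.Site d)) : Set (B1Eq324BenfattoLemma.Site d)) ((Is k).image fun x => x + τ k) (bs k) →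
      ∫ z in smallFieldOn (shrink L m w : Set (B1Eq324BenfattoLemma.Site d)) ((Is k).image fun x => x + τ k) (bs k),
          Real.exp (psiBox s D κ (shiftCoef (as k) (-τ k)) L w m z) ∂((gaussianFieldOfKernel (Kbs k m)).map
              fun (ζ' : B1Eq324BenfattoLemma.Site d → ℝ) (x : B1Eq324BenfattoLemma.Site d) =>
                condMean (fun x y => K (x + σ (k + 1)) (y + σ (k + 1))) ((Cs k).image (fun x => x + τ k) ∪ corridors L w (Bs k)) ξ x + ζ' x)
        ≤ Real.exp (u k m) * ∫ z in smallFieldOn (shrink L m w : Set (B1Eq324BenfattoLemma.Site d)) ((Is k).image fun x => x + τ k) (bs k),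
          Real.exp (psi1p s D κ (shiftCoef (as k) (-τ k)) L w v m z + psi2 s D κ (shiftCoef (as k) (-τ k)) L w m z)
            ∂((gaussianFieldOfKernel (Kbs k m)).map
              fun (ζ' : B1Eq324BenfattoLemma.Site d → ℝ) (x : B1Eq324BenfattoLemma.Site d) =>
                condMean (fun x y => K (x + σ (k + 1)) (y + σ (k + 1))) ((Cs k).image (fun x => x + τ k) ∪ corridors L w (Bs k)) ξ x + ζ' x)) :
    ∫ z, cutoffBoltzmann (hamiltonian s D κ (as (0)) (Js (0))) (Is (0)) (γ * bs (0)) z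
          ∂((gaussianFieldOfKernel (condCov (K) (Cs (0)))).map
          fun (ζ' : B1Eq324BenfattoLemma.Site d → ℝ) (x : B1Eq324BenfattoLemma.Site d) => condMean (K) (Cs (0)) (zs (0)) x + ζ' x) ≤
      Real.exp (∑ k ∈ Finset.range n,
          (s1Const s D d κ * Ac * (γ * bs k) ^ D * Real.exp (-(κ / 4 * w)) * (Js k).card
            + s1Const s D d κ * Ac * bs k ^ D *
              (Real.exp (-(κ / 4 * w)) * (corridorsBar L w v (Bs k)).card + Real.exp (-(κ / 4 * v)) * ((Bs k).card * (L : ℝ) ^ d))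
            + 2 * ((∑ y : ↥((Λ.image fun y => y - σ (k + 1)) \ ((Cs k).image (fun x => x + τ k) ∪ corridors L w (Bs k))),
                Jc / (Real.cosh (θ * max (w : ℝ) (distToRegion ((Bs k).biUnion (box L)) y)) - 1)) / (γA - Jc / (Real.cosh (θ * w) - 1)) +
              ((1 + V * M / (γA - Jc)) ^ 2 * bs k ^ 2 *
              ∑ y : ↥((Λ.image fun y => y - σ (k + 1)) \ ((Cs k).image (fun x => x + τ k) ∪ corridors L w (Bs k))),
                Jc / (Real.cosh (θ * max (w : ℝ) (distToRegion ((Bs k).biUnion (box L)) y)) - 1) *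
                  (1 + distToRegion ((Is k).image fun x => x + τ k) y) ^ 2) / 2)
            + ∑ m ∈ Bs k, u k m)) *
        ∫ z, cutoffBoltzmann (hamiltonian s D κ (as (n)) (Js (n))) (Is (n)) (γ * bs (n)) z
          ∂((gaussianFieldOfKernel (condCov (fun x y => K (x + σ (n)) (y + σ (n))) (Cs (n)))).map
          fun (ζ' : B1Eq324BenfattoLemma.Site d → ℝ) (x : B1Eq324BenfattoLemma.Site d) => condMean (fun x y => K (x + σ (n)) (y + σ (n))) (Cs (n)) (zs (n)) x + ζ' x) := by
  classical
  have hinv := chain_invariants hsupp hA hJI hrecJ hrecI hreca (n := n)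
  have hchain := le_exp_sum_mul_of_steps
    (fun k => ∫ z, cutoffBoltzmann (hamiltonian s D κ (as (k)) (Js (k))) (Is (k)) (γ * bs (k)) z
          ∂((gaussianFieldOfKernel (condCov (fun x y => K (x + σ (k)) (y + σ (k))) (Cs (k)))).map
          fun (ζ' : B1Eq324BenfattoLemma.Site d → ℝ) (x : B1Eq324BenfattoLemma.Site d) => condMean (fun x y => K (x + σ (k)) (y + σ (k))) (Cs (k)) (zs (k)) x + ζ' x))
    (fun k => (s1Const s D d κ * Ac * (γ * bs k) ^ D * Real.exp (-(κ / 4 * w)) * (Js k).card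
            + s1Const s D d κ * Ac * bs k ^ D *
              (Real.exp (-(κ / 4 * w)) * (corridorsBar L w v (Bs k)).card + Real.exp (-(κ / 4 * v)) * ((Bs k).card * (L : ℝ) ^ d))
            + 2 * ((∑ y : ↥((Λ.image fun y => y - σ (k + 1)) \ ((Cs k).image (fun x => x + τ k) ∪ corridors L w (Bs k))),
                Jc / (Real.cosh (θ * max (w : ℝ) (distToRegion ((Bs k).biUnion (box L)) y)) - 1)) / (γA - Jc / (Real.cosh (θ * w) - 1)) +
              ((1 + V * M / (γA - Jc)) ^ 2 * bs k ^ 2 *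
              ∑ y : ↥((Λ.image fun y => y - σ (k + 1)) \ ((Cs k).image (fun x => x + τ k) ∪ corridors L w (Bs k))),
                Jc / (Real.cosh (θ * max (w : ℝ) (distToRegion ((Bs k).biUnion (box L)) y)) - 1) *
                  (1 + distToRegion ((Is k).image fun x => x + τ k) y) ^ 2) / 2)
            + ∑ m ∈ Bs k, u k m)) n (fun k hk => by
      obtain ⟨h1, h2, h3, -⟩ := hinv k hk.le
      have hstep := upperPavementStep_of_classRows_frame hK hAs hγA0 hγA hθ hJc hJcγ hV hM hguard hκ h1 hAc0 h2 h3 hL hw hv hγ1 (hb k hk)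
        (hγb k hk) (σ (k + 1)) (τ k) (zs k) (hCΛ k hk) (hΓΛ k hk) (hBΛ k hk) (hB k hk) (hKbs k hk) (u k) (hbox k hk) (s := s) (D := D)
      have hσk : σ k = τ k + σ (k + 1) := by
        rw [hrecσ k hk]
        abel
      show ∫ z, cutoffBoltzmann (hamiltonian s D κ (as (k)) (Js (k))) (Is (k)) (γ * bs (k)) z
          ∂((gaussianFieldOfKernel (condCov (fun x y => K (x + σ (k)) (y + σ (k))) (Cs (k)))).map
          fun (ζ' : B1Eq324BenfattoLemma.Site d → ℝ) (x : B1Eq324BenfattoLemma.Site d) => condMean (fun x y => K (x + σ (k)) (y + σ (k))) (Cs (k)) (zs (k)) x + ζ' x) ≤ _ * ∫ z, cutoffBoltzmann (hamiltonian s D κ (as (k + 1)) (Js (k + 1))) (Is (k + 1)) (γ * bs (k + 1)) z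
          ∂((gaussianFieldOfKernel (condCov (fun x y => K (x + σ (k + 1)) (y + σ (k + 1))) (Cs (k + 1)))).map
          fun (ζ' : B1Eq324BenfattoLemma.Site d → ℝ) (x : B1Eq324BenfattoLemma.Site d) => condMean (fun x y => K (x + σ (k + 1)) (y + σ (k + 1))) (Cs (k + 1)) (zs (k + 1)) x + ζ' x)
      rw [hrecJ k hk, hrecI k hk, hreca k hk, hrecC k hk, hrecz k hk, hrecb k hk, hσk]
      exact hstep)
  have hZ0 : (fun x y : B1Eq324BenfattoLemma.Site d => K (x + σ 0) (y + σ 0)) = K := by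
    funext x y
    rw [hσ0, add_zero, add_zero]
  rw [hZ0] at hchain
  exact hchain

/-- **THE (4.6)-SIDE DRIVER FOR THE CLASS** — after `d + 1` suitably displaced steps (`…Sect5PavementChain.chain_eq_empty_of_sep`: `J_{d+1} = ∅`) the
terminal conditioned integral is the small-field VOLUME of the probability measure `P̄^{K(·+σ_{d+1})}_{C_{d+1},z̄_{d+1}}` (`…KernelSect5Termination.
integral_cutoffBoltzmann_empty_measure`, `…KernelCondField.isProbabilityMeasure_condFieldK`), hence `≤ 1`:
`∫Π_Δχ̂^{I_0}_{γb_0}e^{H^{A_0}_{J_0}}dP̄^K_{C_0,z̄_0} ≤ exp(Σ_{k≤d}(err₅₁₁(k) + err₅₃₄(k) + 2P′_k + Σ_{□∈B_k}u_k(□)))`, the per-box exponents displayed.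
[cite: BenfattoEtAl1978, §5 (5.36) p.159, (4.6) p.152, p.154 «the trivial case H_J = 0» (class form; ours)] -/
theorem upperPavementChainCond_le_exp
    (hAs : ∀ e e', A e e' = A e' e) {γA : ℝ} (hγA0 : 0 < γA)
    (hγA : ∀ x : Λ → ℝ, γA * ∑ e, x e ^ 2 ≤ ∑ e, ∑ e', A e e' * x e * x e')
    {θ Jc V M : ℝ} (hθ : 0 < θ)
    (hJc : ∀ e : Λ, ∑ e' : Λ, |A e e'| * (Real.cosh (θ * Real.sqrt (∑ j, ((((e : B1Eq324BenfattoLemma.Site d) j : ℝ) - ((e' : B1Eq324BenfattoLemma.Site d) j : ℝ))) ^ 2)) - 1) ≤ Jc)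
    (hJcγ : Jc < γA)
    (hV : ∀ e : Λ, ∑ e' : Λ, Real.exp (-(θ * Real.sqrt (∑ j, ((((e : B1Eq324BenfattoLemma.Site d) j : ℝ) - ((e' : B1Eq324BenfattoLemma.Site d) j : ℝ))) ^ 2))) *
      (1 + Real.sqrt (∑ j, ((((e : B1Eq324BenfattoLemma.Site d) j : ℝ) - ((e' : B1Eq324BenfattoLemma.Site d) j : ℝ))) ^ 2)) ≤ V)
    (hM : ∀ e : Λ, ∑ e' : Λ, |A e e'| * (1 + Real.sqrt (∑ j, ((((e : B1Eq324BenfattoLemma.Site d) j : ℝ) - ((e' : B1Eq324BenfattoLemma.Site d) j : ℝ))) ^ 2)) ≤ M)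
    (hguard : Jc / (Real.cosh (θ * w) - 1) < γA)
    (hκ : 0 < κ) (hL : 0 < L) (hw : 0 < w) (hv : v ≤ w) (hγ1 : γ ≤ 1) (hAc0 : 0 ≤ Ac)
    {Js Is Bs Cs : ℕ → Finset (B1Eq324BenfattoLemma.Site d)} {as : ℕ → Coef d} {zs : ℕ → B1Eq324BenfattoLemma.Site d → ℝ} {bs : ℕ → ℝ}
    {τ σ : ℕ → B1Eq324BenfattoLemma.Site d}
    (hsupp : CoefSupportedIn (as 0) (Js 0))
    (hA : ∀ (p : ℕ) (Δ : Fin p → B1Eq324BenfattoLemma.Site d) (nn : Fin p → ℕ), |as 0 p Δ nn| ≤ Ac) (hJI : Js 0 ⊆ Is 0)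
    (hrecJ : ∀ k < d + 1, Js (k + 1) = (Js k).image (fun x => x + τ k) ∩ corridorsBar L w v (Bs k))
    (hrecI : ∀ k < d + 1, Is (k + 1) = (Is k).image fun x => x + τ k)
    (hreca : ∀ k < d + 1, as (k + 1) = restrictCoef (shiftCoef (as k) (-τ k)) (corridorsBar L w v (Bs k)))
    (hrecC : ∀ k < d + 1, Cs (k + 1) = (Cs k).image fun x => x + τ k)
    (hrecz : ∀ k < d + 1, zs (k + 1) = fun y => zs k (y - τ k))
    (hrecb : ∀ k < d + 1, γ * bs (k + 1) = bs k) (hb : ∀ k < d + 1, 1 ≤ bs k) (hγb : ∀ k < d + 1, 1 ≤ γ * bs k)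
    (hσ0 : σ 0 = 0) (hrecσ : ∀ k < d + 1, σ (k + 1) = σ k - τ k)
    (hB : ∀ k < d + 1, ((Js k).image fun x => x + τ k).image (boxIndex L) ⊆ Bs k)
    (hCΛ : ∀ k < d + 1, (Cs k).image (fun x => x + τ k) ⊆ Λ.image fun y => y - σ (k + 1))
    (hΓΛ : ∀ k < d + 1, corridors L w (Bs k) ⊆ Λ.image fun y => y - σ (k + 1))
    (hBΛ : ∀ k, k < d + 1 → ∀ m ∈ Bs k, box L m ⊆ Λ.image fun y => y - σ (k + 1))
    {Kbs : ℕ → B1Eq324BenfattoLemma.Site d → B1Eq324BenfattoLemma.Site d → B1Eq324BenfattoLemma.Site d → ℝ}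
    (hKbs : ∀ k (hk : k < d + 1) m (hm : m ∈ Bs k) x y, Kbs k m x y =
      if h : x ∈ shrink L m w \ (Cs k).image (fun x => x + τ k) ∧ y ∈ shrink L m w \ (Cs k).image (fun x => x + τ k) then
      (((A.submatrix (fun j : ↥(Λ.image fun y => y - σ (k + 1)) => (⟨(j : B1Eq324BenfattoLemma.Site d) + σ (k + 1), (mem_image_sub_iff (σ (k + 1))).mp j.2⟩ : Λ))
          (fun j : ↥(Λ.image fun y => y - σ (k + 1)) => (⟨(j : B1Eq324BenfattoLemma.Site d) + σ (k + 1), (mem_image_sub_iff (σ (k + 1))).mp j.2⟩ : Λ))).submatrix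
          (fun j : ↥(shrink L m w \ (Cs k).image (fun x => x + τ k)) =>
            (⟨j, hBΛ k hk m hm (shrink_subset_box L m w (Finset.mem_sdiff.mp j.2).1)⟩ : ↥(Λ.image fun y => y - σ (k + 1))))
          (fun j : ↥(shrink L m w \ (Cs k).image (fun x => x + τ k)) =>
            (⟨j, hBΛ k hk m hm (shrink_subset_box L m w (Finset.mem_sdiff.mp j.2).1)⟩ : ↥(Λ.image fun y => y - σ (k + 1)))))⁻¹ :
          Matrix ↥(shrink L m w \ (Cs k).image (fun x => x + τ k)) ↥(shrink L m w \ (Cs k).image (fun x => x + τ k)) ℝ)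
            ⟨x, h.1⟩ ⟨y, h.2⟩ else 0)
    (u : ℕ → B1Eq324BenfattoLemma.Site d → ℝ)
    (hbox : ∀ k < d + 1, ∀ m ∈ Bs k, ∀ ξ : B1Eq324BenfattoLemma.Site d → ℝ,
      ξ ∈ smallFieldOn (corridors L w (Bs k) : Set (B1Eq324BenfattoLemma.Site d)) ((Is k).image fun x => x + τ k) (γ * bs k) →
      ξ ∈ smallFieldOn (((Cs k).image fun x => x + τ k : Finset (B1Eq324BenfattoLemma.Site d)) : Set (B1Eq324BenfattoLemma.Site d)) ((Is k).image fun x => x + τ k) (bs k) →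
      ∫ z in smallFieldOn (shrink L m w : Set (B1Eq324BenfattoLemma.Site d)) ((Is k).image fun x => x + τ k) (bs k),
          Real.exp (psiBox s D κ (shiftCoef (as k) (-τ k)) L w m z) ∂((gaussianFieldOfKernel (Kbs k m)).map
              fun (ζ' : B1Eq324BenfattoLemma.Site d → ℝ) (x : B1Eq324BenfattoLemma.Site d) =>
                condMean (fun x y => K (x + σ (k + 1)) (y + σ (k + 1))) ((Cs k).image (fun x => x + τ k) ∪ corridors L w (Bs k)) ξ x + ζ' x)
        ≤ Real.exp (u k m) * ∫ z in smallFieldOn (shrink L m w : Set (B1Eq324BenfattoLemma.Site d)) ((Is k).image fun x => x + τ k) (bs k),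
          Real.exp (psi1p s D κ (shiftCoef (as k) (-τ k)) L w v m z + psi2 s D κ (shiftCoef (as k) (-τ k)) L w m z)
            ∂((gaussianFieldOfKernel (Kbs k m)).map
              fun (ζ' : B1Eq324BenfattoLemma.Site d → ℝ) (x : B1Eq324BenfattoLemma.Site d) =>
                condMean (fun x y => K (x + σ (k + 1)) (y + σ (k + 1))) ((Cs k).image (fun x => x + τ k) ∪ corridors L w (Bs k)) ξ x + ζ' x))
    (hsep : ∀ j j' : Fin (d + 1), j ≠ j' → ∀ (i : Fin d) (q : ℤ),
      (2 * (2 * w + v : ℕ) : ℤ) ≤ |(-(∑ i' ∈ Finset.range ((j : ℕ) + 1), τ i')) i - (-(∑ i' ∈ Finset.range ((j' : ℕ) + 1), τ i')) i - q * L|) :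
    ∫ z, cutoffBoltzmann (hamiltonian s D κ (as (0)) (Js (0))) (Is (0)) (γ * bs (0)) z
          ∂((gaussianFieldOfKernel (condCov (K) (Cs (0)))).map
          fun (ζ' : B1Eq324BenfattoLemma.Site d → ℝ) (x : B1Eq324BenfattoLemma.Site d) => condMean (K) (Cs (0)) (zs (0)) x + ζ' x) ≤
      Real.exp (∑ k ∈ Finset.range (d + 1),
          (s1Const s D d κ * Ac * (γ * bs k) ^ D * Real.exp (-(κ / 4 * w)) * (Js k).card
            + s1Const s D d κ * Ac * bs k ^ D *
              (Real.exp (-(κ / 4 * w)) * (corridorsBar L w v (Bs k)).card + Real.exp (-(κ / 4 * v)) * ((Bs k).card * (L : ℝ) ^ d))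
            + 2 * ((∑ y : ↥((Λ.image fun y => y - σ (k + 1)) \ ((Cs k).image (fun x => x + τ k) ∪ corridors L w (Bs k))),
                Jc / (Real.cosh (θ * max (w : ℝ) (distToRegion ((Bs k).biUnion (box L)) y)) - 1)) / (γA - Jc / (Real.cosh (θ * w) - 1)) +
              ((1 + V * M / (γA - Jc)) ^ 2 * bs k ^ 2 *
              ∑ y : ↥((Λ.image fun y => y - σ (k + 1)) \ ((Cs k).image (fun x => x + τ k) ∪ corridors L w (Bs k))),
                Jc / (Real.cosh (θ * max (w : ℝ) (distToRegion ((Bs k).biUnion (box L)) y)) - 1) *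
                  (1 + distToRegion ((Is k).image fun x => x + τ k) y) ^ 2) / 2)
            + ∑ m ∈ Bs k, u k m)) := by
  classical
  have hchain := upperPavementChainCond hK hAs hγA0 hγA hθ hJc hJcγ hV hM hguard hκ hL hw hv hγ1 hAc0 hsupp hA hJI hrecJ hrecI hreca hrecC hrecz
    hrecb hb hγb hσ0 hrecσ hB hCΛ hΓΛ hBΛ hKbs u hbox (s := s) (D := D)
  have hJe : Js (d + 1) = ∅ := chain_eq_empty_of_sep hL hrecJ hsep
  -- the terminal conditioned class field is a probability measure
  have hKσ := kernel_translate (σ (d + 1)) hK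
  have hApdσ := posDef_of_coercive (submatrix_translate_symm (σ (d + 1)) hAs) hγA0 (submatrix_translate_coercive (σ (d + 1)) hγA)
  have hCd : Cs (d + 1) ⊆ Λ.image fun y => y - σ (d + 1) := by
    rw [hrecC d (Nat.lt_succ_self d)]
    exact hCΛ d (Nat.lt_succ_self d)
  haveI := isProbabilityMeasure_condFieldK (isPosSemidefKernel_kernel hKσ hApdσ) (Cs (d + 1))
    (isUnit_det_covGram_kernel hKσ hApdσ hCd) (zs (d + 1))
  have hterm : ∫ z, cutoffBoltzmann (hamiltonian s D κ (as (d + 1)) (Js (d + 1))) (Is (d + 1)) (γ * bs (d + 1)) z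
          ∂((gaussianFieldOfKernel (condCov (fun x y => K (x + σ (d + 1)) (y + σ (d + 1))) (Cs (d + 1)))).map
          fun (ζ' : B1Eq324BenfattoLemma.Site d → ℝ) (x : B1Eq324BenfattoLemma.Site d) => condMean (fun x y => K (x + σ (d + 1)) (y + σ (d + 1))) (Cs (d + 1)) (zs (d + 1)) x + ζ' x) ≤ 1 := by
    rw [hJe, integral_cutoffBoltzmann_empty_measure]
    exact measureReal_le_one
  refine hchain.trans ?_
  have h := mul_le_mul_of_nonneg_left hterm (Real.exp_pos (∑ k ∈ Finset.range (d + 1),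
          (s1Const s D d κ * Ac * (γ * bs k) ^ D * Real.exp (-(κ / 4 * w)) * (Js k).card
            + s1Const s D d κ * Ac * bs k ^ D *
              (Real.exp (-(κ / 4 * w)) * (corridorsBar L w v (Bs k)).card + Real.exp (-(κ / 4 * v)) * ((Bs k).card * (L : ℝ) ^ d))
            + 2 * ((∑ y : ↥((Λ.image fun y => y - σ (k + 1)) \ ((Cs k).image (fun x => x + τ k) ∪ corridors L w (Bs k))),
                Jc / (Real.cosh (θ * max (w : ℝ) (distToRegion ((Bs k).biUnion (box L)) y)) - 1)) / (γA - Jc / (Real.cosh (θ * w) - 1)) +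
              ((1 + V * M / (γA - Jc)) ^ 2 * bs k ^ 2 *
              ∑ y : ↥((Λ.image fun y => y - σ (k + 1)) \ ((Cs k).image (fun x => x + τ k) ∪ corridors L w (Bs k))),
                Jc / (Real.cosh (θ * max (w : ℝ) (distToRegion ((Bs k).biUnion (box L)) y)) - 1) *
                  (1 + distToRegion ((Is k).image fun x => x + τ k) y) ^ 2) / 2)
            + ∑ m ∈ Bs k, u k m))).le
  rwa [mul_one] at h

end Chain

/-! ## §5 (v1.1, APPEND-ONLY)  The parts adapter: standard part kernels serve the conditional / upper steps when `C` misses the boxes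

The conditional and upper steps (`…KernelSect5Eq536`, `…KernelSect5UpperStep`, §§1–4 above) cut `Λ − (C ∪ Γ₁)` into the parts `shrink L m w − C`;
the cluster side's part kernels and depth rows (`…KernelSect5PerBoxAtPavement`, `…KernelSect5PartFieldRows`) are stated for the parts `shrink L m w`.
In print `C` is at distance `b³ ≫ L` from `J` (Lemma p. 152), so `C` misses every box of the pavement and the two part systems coincide; the lemma
below turns the standard definitional part-kernel row into the `− C` row for the SAME kernel family, by re-indexing the sub-precision along
`↥(shrink L m w − C) ≃ ↥(shrink L m w)` (`Matrix.inv_submatrix_equiv`). -/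

section Parts

variable {Λ : Finset (B1Eq324BenfattoLemma.Site d)} {A : Matrix Λ Λ ℝ} {L w : ℕ} {B C : Finset (B1Eq324BenfattoLemma.Site d)}

/-- **PARTS ADAPTER**: if every `shrink L m w`, `m ∈ B`, is disjoint from `C`, the standard part-kernel row (parts `shrink L m w`, the currency of
`…KernelSect5PavementStep` / `…KernelSect5PerBoxAtPavement` / `…KernelSect5PartFieldRows`) implies the conditional steps' row (parts `shrink L m w − C`,
the currency of `…KernelSect5Eq536` / `…KernelSect5UpperStep` / `upperPavementChainCond`) for the same kernel family `Kb`.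
[cite: BenfattoEtAl1978, Lemma p.152 «at distance b³ from J», §5 (5.36) p.159 (class form; ours)] -/
theorem partKernel_row_sdiff_of_disjoint (hBΛ : ∀ m ∈ B, box L m ⊆ Λ)
    {Kb : B1Eq324BenfattoLemma.Site d → B1Eq324BenfattoLemma.Site d → B1Eq324BenfattoLemma.Site d → ℝ}
    (hKb : ∀ m (hm : m ∈ B) x y, Kb m x y = if h : x ∈ shrink L m w ∧ y ∈ shrink L m w then
      ((A.submatrix (fun j : ↥(shrink L m w) => (⟨j, hBΛ m hm (shrink_subset_box L m w j.2)⟩ : Λ))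
        (fun j : ↥(shrink L m w) => (⟨j, hBΛ m hm (shrink_subset_box L m w j.2)⟩ : Λ)))⁻¹ :
          Matrix ↥(shrink L m w) ↥(shrink L m w) ℝ) ⟨x, h.1⟩ ⟨y, h.2⟩ else 0)
    (hdisj : ∀ m ∈ B, Disjoint (shrink L m w) C) :
    ∀ m (hm : m ∈ B) x y, Kb m x y = if h : x ∈ shrink L m w \ C ∧ y ∈ shrink L m w \ C then
      ((A.submatrix (fun j : ↥(shrink L m w \ C) => (⟨j, hBΛ m hm (shrink_subset_box L m w (Finset.mem_sdiff.mp j.2).1)⟩ : Λ))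
        (fun j : ↥(shrink L m w \ C) => (⟨j, hBΛ m hm (shrink_subset_box L m w (Finset.mem_sdiff.mp j.2).1)⟩ : Λ)))⁻¹ :
          Matrix ↥(shrink L m w \ C) ↥(shrink L m w \ C) ℝ) ⟨x, h.1⟩ ⟨y, h.2⟩ else 0 := by
  classical
  intro m hm x y
  have hS : shrink L m w \ C = shrink L m w := Finset.sdiff_eq_self_of_disjoint (hdisj m hm)
  -- the re-indexing of the part along the set equality
  let e : ↥(shrink L m w \ C) ≃ ↥(shrink L m w) :=
    { toFun := fun j => ⟨j, (Finset.mem_sdiff.mp j.2).1⟩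
      invFun := fun j => ⟨j, hS.symm ▸ j.2⟩
      left_inv := fun j => Subtype.ext rfl
      right_inv := fun j => Subtype.ext rfl }
  rw [hKb m hm]
  by_cases hxy : x ∈ shrink L m w ∧ y ∈ shrink L m w
  · have hxy' : x ∈ shrink L m w \ C ∧ y ∈ shrink L m w \ C := ⟨hS.symm ▸ hxy.1, hS.symm ▸ hxy.2⟩
    rw [dif_pos hxy, dif_pos hxy']
    have hsub : (A.submatrix (fun j : ↥(shrink L m w \ C) => (⟨j, hBΛ m hm (shrink_subset_box L m w (Finset.mem_sdiff.mp j.2).1)⟩ : Λ))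
        (fun j : ↥(shrink L m w \ C) => (⟨j, hBΛ m hm (shrink_subset_box L m w (Finset.mem_sdiff.mp j.2).1)⟩ : Λ))) =
        (A.submatrix (fun j : ↥(shrink L m w) => (⟨j, hBΛ m hm (shrink_subset_box L m w j.2)⟩ : Λ))
          (fun j : ↥(shrink L m w) => (⟨j, hBΛ m hm (shrink_subset_box L m w j.2)⟩ : Λ))).submatrix e e := by
      ext i j
      rfl
    rw [hsub, Matrix.inv_submatrix_equiv]
    rfl
  · have hxy' : ¬(x ∈ shrink L m w \ C ∧ y ∈ shrink L m w \ C) := fun h => hxy ⟨hS ▸ h.1, hS ▸ h.2⟩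
    rw [dif_neg hxy, dif_neg hxy']

end Parts

/-! ## §6 (v1.2, APPEND-ONLY)  The (4.6)-side driver AT THE STOPPING INDEX

`upperPavementChainCond_le_exp` (§4) runs the fixed `d + 1` separated steps of print and pays the closed-form price `2P′_k` at every step; at a step
with an EMPTY pavement `B_k = ∅` the cross rows `r_y = J_c/(cosh(θ·max(w, d(y, ⋃_{□∈B_k}□))) − 1)` take the junk distance `0` to the empty region, so
`2P′_k` is `|Λ|`-extensive there (seat n08-b's located point, bus 2026-08-28 09:28Z) — exactly as on the (4.7) side (`…KernelSect5PavementChain` §5,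
v1.1).  The remedy is the same: STOP AT THE FIRST EMPTY INDEX.  The theorem below is §4's driver for `n` steps with `J_n = ∅` in place of the
separation of the displacements, the terminal conditioned volume being `≤ 1` (the terminal conditioned class field is a probability measure once
`C_n` lies in the frame region — from `C_0 ⊆ Λ` at `n = 0`, from the last recursion row otherwise). -/

section StoppingIndex

variable {Λ : Finset (B1Eq324BenfattoLemma.Site d)} {A : Matrix Λ Λ ℝ}
  {K : B1Eq324BenfattoLemma.Site d → B1Eq324BenfattoLemma.Site d → ℝ}
  (hK : ∀ x y, K x y = if h : x ∈ Λ ∧ y ∈ Λ then (A⁻¹ : Matrix Λ Λ ℝ) ⟨x, h.1⟩ ⟨y, h.2⟩ else 0)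
  {s D : ℕ} {κ : ℝ} {L w v : ℕ} {γ Ac : ℝ}

include hK

/-- **THE (4.6)-SIDE DRIVER FOR THE CLASS AT THE STOPPING INDEX** — under the hypotheses of `upperPavementChainCond` (`n` steps), `C_0 ⊆ Λ` and
`J_n = ∅`, the terminal conditioned integral is the small-field VOLUME of the probability measure `P̄^{K(·+σ_n)}_{C_n,z̄_n}`
(`…KernelSect5Termination.integral_cutoffBoltzmann_empty_measure`, `…KernelCondField.isProbabilityMeasure_condFieldK`), hence `≤ 1`:
`∫Π_Δχ̂^{I_0}_{γb_0}e^{H^{A_0}_{J_0}}dP̄^K_{C_0,z̄_0} ≤ exp(Σ_{k<n}(err₅₁₁(k) + err₅₃₄(k) + 2P′_k + Σ_{□∈B_k}u_k(□)))` — `upperPavementChainCond_le_exp` with the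
separation hypothesis `hsep` REPLACED by `J_n = ∅` at a general `n` (print: «After (d + 1) steps, (in general less) we end up in the free case»; the
consumer stops at the first empty index so that no step runs on an empty pavement).
[cite: BenfattoEtAl1978, §5 (5.36) p.159, (4.6) p.152, p.154 «(in general less)», «the trivial case H_J = 0» (class form; ours)] -/
theorem upperPavementChainCond_le_exp_of_eq_empty
    (hAs : ∀ e e', A e e' = A e' e) {γA : ℝ} (hγA0 : 0 < γA)
    (hγA : ∀ x : Λ → ℝ, γA * ∑ e, x e ^ 2 ≤ ∑ e, ∑ e', A e e' * x e * x e')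
    {θ Jc V M : ℝ} (hθ : 0 < θ)
    (hJc : ∀ e : Λ, ∑ e' : Λ, |A e e'| * (Real.cosh (θ * Real.sqrt (∑ j, ((((e : B1Eq324BenfattoLemma.Site d) j : ℝ) - ((e' : B1Eq324BenfattoLemma.Site d) j : ℝ))) ^ 2)) - 1) ≤ Jc)
    (hJcγ : Jc < γA)
    (hV : ∀ e : Λ, ∑ e' : Λ, Real.exp (-(θ * Real.sqrt (∑ j, ((((e : B1Eq324BenfattoLemma.Site d) j : ℝ) - ((e' : B1Eq324BenfattoLemma.Site d) j : ℝ))) ^ 2))) *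
      (1 + Real.sqrt (∑ j, ((((e : B1Eq324BenfattoLemma.Site d) j : ℝ) - ((e' : B1Eq324BenfattoLemma.Site d) j : ℝ))) ^ 2)) ≤ V)
    (hM : ∀ e : Λ, ∑ e' : Λ, |A e e'| * (1 + Real.sqrt (∑ j, ((((e : B1Eq324BenfattoLemma.Site d) j : ℝ) - ((e' : B1Eq324BenfattoLemma.Site d) j : ℝ))) ^ 2)) ≤ M)
    (hguard : Jc / (Real.cosh (θ * w) - 1) < γA)
    (hκ : 0 < κ) (hL : 0 < L) (hw : 0 < w) (hv : v ≤ w) (hγ1 : γ ≤ 1) (hAc0 : 0 ≤ Ac) {n : ℕ}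
    {Js Is Bs Cs : ℕ → Finset (B1Eq324BenfattoLemma.Site d)} {as : ℕ → Coef d} {zs : ℕ → B1Eq324BenfattoLemma.Site d → ℝ} {bs : ℕ → ℝ}
    {τ σ : ℕ → B1Eq324BenfattoLemma.Site d}
    (hsupp : CoefSupportedIn (as 0) (Js 0))
    (hA : ∀ (p : ℕ) (Δ : Fin p → B1Eq324BenfattoLemma.Site d) (nn : Fin p → ℕ), |as 0 p Δ nn| ≤ Ac) (hJI : Js 0 ⊆ Is 0)
    (hrecJ : ∀ k < n, Js (k + 1) = (Js k).image (fun x => x + τ k) ∩ corridorsBar L w v (Bs k))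
    (hrecI : ∀ k < n, Is (k + 1) = (Is k).image fun x => x + τ k)
    (hreca : ∀ k < n, as (k + 1) = restrictCoef (shiftCoef (as k) (-τ k)) (corridorsBar L w v (Bs k)))
    (hrecC : ∀ k < n, Cs (k + 1) = (Cs k).image fun x => x + τ k)
    (hrecz : ∀ k < n, zs (k + 1) = fun y => zs k (y - τ k))
    (hrecb : ∀ k < n, γ * bs (k + 1) = bs k) (hb : ∀ k < n, 1 ≤ bs k) (hγb : ∀ k < n, 1 ≤ γ * bs k)
    (hσ0 : σ 0 = 0) (hrecσ : ∀ k < n, σ (k + 1) = σ k - τ k)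
    (hB : ∀ k < n, ((Js k).image fun x => x + τ k).image (boxIndex L) ⊆ Bs k)
    (hCΛ : ∀ k < n, (Cs k).image (fun x => x + τ k) ⊆ Λ.image fun y => y - σ (k + 1))
    (hΓΛ : ∀ k < n, corridors L w (Bs k) ⊆ Λ.image fun y => y - σ (k + 1))
    (hBΛ : ∀ k, k < n → ∀ m ∈ Bs k, box L m ⊆ Λ.image fun y => y - σ (k + 1))
    {Kbs : ℕ → B1Eq324BenfattoLemma.Site d → B1Eq324BenfattoLemma.Site d → B1Eq324BenfattoLemma.Site d → ℝ}
    (hKbs : ∀ k (hk : k < n) m (hm : m ∈ Bs k) x y, Kbs k m x y =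
      if h : x ∈ shrink L m w \ (Cs k).image (fun x => x + τ k) ∧ y ∈ shrink L m w \ (Cs k).image (fun x => x + τ k) then
      (((A.submatrix (fun j : ↥(Λ.image fun y => y - σ (k + 1)) => (⟨(j : B1Eq324BenfattoLemma.Site d) + σ (k + 1), (mem_image_sub_iff (σ (k + 1))).mp j.2⟩ : Λ))
          (fun j : ↥(Λ.image fun y => y - σ (k + 1)) => (⟨(j : B1Eq324BenfattoLemma.Site d) + σ (k + 1), (mem_image_sub_iff (σ (k + 1))).mp j.2⟩ : Λ))).submatrix
          (fun j : ↥(shrink L m w \ (Cs k).image (fun x => x + τ k)) =>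
            (⟨j, hBΛ k hk m hm (shrink_subset_box L m w (Finset.mem_sdiff.mp j.2).1)⟩ : ↥(Λ.image fun y => y - σ (k + 1))))
          (fun j : ↥(shrink L m w \ (Cs k).image (fun x => x + τ k)) =>
            (⟨j, hBΛ k hk m hm (shrink_subset_box L m w (Finset.mem_sdiff.mp j.2).1)⟩ : ↥(Λ.image fun y => y - σ (k + 1)))))⁻¹ :
          Matrix ↥(shrink L m w \ (Cs k).image (fun x => x + τ k)) ↥(shrink L m w \ (Cs k).image (fun x => x + τ k)) ℝ)
            ⟨x, h.1⟩ ⟨y, h.2⟩ else 0)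
    (u : ℕ → B1Eq324BenfattoLemma.Site d → ℝ)
    (hbox : ∀ k < n, ∀ m ∈ Bs k, ∀ ξ : B1Eq324BenfattoLemma.Site d → ℝ,
      ξ ∈ smallFieldOn (corridors L w (Bs k) : Set (B1Eq324BenfattoLemma.Site d)) ((Is k).image fun x => x + τ k) (γ * bs k) →
      ξ ∈ smallFieldOn (((Cs k).image fun x => x + τ k : Finset (B1Eq324BenfattoLemma.Site d)) : Set (B1Eq324BenfattoLemma.Site d)) ((Is k).image fun x => x + τ k) (bs k) →
      ∫ z in smallFieldOn (shrink L m w : Set (B1Eq324BenfattoLemma.Site d)) ((Is k).image fun x => x + τ k) (bs k),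
          Real.exp (psiBox s D κ (shiftCoef (as k) (-τ k)) L w m z) ∂((gaussianFieldOfKernel (Kbs k m)).map
              fun (ζ' : B1Eq324BenfattoLemma.Site d → ℝ) (x : B1Eq324BenfattoLemma.Site d) =>
                condMean (fun x y => K (x + σ (k + 1)) (y + σ (k + 1))) ((Cs k).image (fun x => x + τ k) ∪ corridors L w (Bs k)) ξ x + ζ' x)
        ≤ Real.exp (u k m) * ∫ z in smallFieldOn (shrink L m w : Set (B1Eq324BenfattoLemma.Site d)) ((Is k).image fun x => x + τ k) (bs k),
          Real.exp (psi1p s D κ (shiftCoef (as k) (-τ k)) L w v m z + psi2 s D κ (shiftCoef (as k) (-τ k)) L w m z)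
            ∂((gaussianFieldOfKernel (Kbs k m)).map
              fun (ζ' : B1Eq324BenfattoLemma.Site d → ℝ) (x : B1Eq324BenfattoLemma.Site d) =>
                condMean (fun x y => K (x + σ (k + 1)) (y + σ (k + 1))) ((Cs k).image (fun x => x + τ k) ∪ corridors L w (Bs k)) ξ x + ζ' x))
    (hC0 : Cs 0 ⊆ Λ) (hJn : Js n = ∅) :
    ∫ z, cutoffBoltzmann (hamiltonian s D κ (as (0)) (Js (0))) (Is (0)) (γ * bs (0)) z
          ∂((gaussianFieldOfKernel (condCov (K) (Cs (0)))).map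
          fun (ζ' : B1Eq324BenfattoLemma.Site d → ℝ) (x : B1Eq324BenfattoLemma.Site d) => condMean (K) (Cs (0)) (zs (0)) x + ζ' x) ≤
      Real.exp (∑ k ∈ Finset.range n,
          (s1Const s D d κ * Ac * (γ * bs k) ^ D * Real.exp (-(κ / 4 * w)) * (Js k).card
            + s1Const s D d κ * Ac * bs k ^ D *
              (Real.exp (-(κ / 4 * w)) * (corridorsBar L w v (Bs k)).card + Real.exp (-(κ / 4 * v)) * ((Bs k).card * (L : ℝ) ^ d))
            + 2 * ((∑ y : ↥((Λ.image fun y => y - σ (k + 1)) \ ((Cs k).image (fun x => x + τ k) ∪ corridors L w (Bs k))),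
                Jc / (Real.cosh (θ * max (w : ℝ) (distToRegion ((Bs k).biUnion (box L)) y)) - 1)) / (γA - Jc / (Real.cosh (θ * w) - 1)) +
              ((1 + V * M / (γA - Jc)) ^ 2 * bs k ^ 2 *
              ∑ y : ↥((Λ.image fun y => y - σ (k + 1)) \ ((Cs k).image (fun x => x + τ k) ∪ corridors L w (Bs k))),
                Jc / (Real.cosh (θ * max (w : ℝ) (distToRegion ((Bs k).biUnion (box L)) y)) - 1) *
                  (1 + distToRegion ((Is k).image fun x => x + τ k) y) ^ 2) / 2)
            + ∑ m ∈ Bs k, u k m)) := by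
  classical
  have hchain := upperPavementChainCond hK hAs hγA0 hγA hθ hJc hJcγ hV hM hguard hκ hL hw hv hγ1 hAc0 hsupp hA hJI hrecJ hrecI hreca hrecC hrecz
    hrecb hb hγb hσ0 hrecσ hB hCΛ hΓΛ hBΛ hKbs u hbox (s := s) (D := D)
  -- the terminal conditioning set lies in the frame-`σ_n` region
  have hCd : Cs n ⊆ Λ.image fun y => y - σ n := by
    cases n with
    | zero =>
      intro x hx
      rw [hσ0]
      exact Finset.mem_image.mpr ⟨x, hC0 hx, sub_zero x⟩
    | succ k =>
      rw [hrecC k (Nat.lt_succ_self k)]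
      exact hCΛ k (Nat.lt_succ_self k)
  -- the terminal conditioned class field is a probability measure
  have hKσ := kernel_translate (σ n) hK
  have hApdσ := posDef_of_coercive (submatrix_translate_symm (σ n) hAs) hγA0 (submatrix_translate_coercive (σ n) hγA)
  haveI := isProbabilityMeasure_condFieldK (isPosSemidefKernel_kernel hKσ hApdσ) (Cs n)
    (isUnit_det_covGram_kernel hKσ hApdσ hCd) (zs n)
  have hterm : ∫ z, cutoffBoltzmann (hamiltonian s D κ (as (n)) (Js (n))) (Is (n)) (γ * bs (n)) z
          ∂((gaussianFieldOfKernel (condCov (fun x y => K (x + σ (n)) (y + σ (n))) (Cs (n)))).map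
          fun (ζ' : B1Eq324BenfattoLemma.Site d → ℝ) (x : B1Eq324BenfattoLemma.Site d) => condMean (fun x y => K (x + σ (n)) (y + σ (n))) (Cs (n)) (zs (n)) x + ζ' x) ≤ 1 := by
    rw [hJn, integral_cutoffBoltzmann_empty_measure]
    exact measureReal_le_one
  refine hchain.trans ?_
  have h := mul_le_mul_of_nonneg_left hterm (Real.exp_pos (∑ k ∈ Finset.range n,
          (s1Const s D d κ * Ac * (γ * bs k) ^ D * Real.exp (-(κ / 4 * w)) * (Js k).card
            + s1Const s D d κ * Ac * bs k ^ D *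
              (Real.exp (-(κ / 4 * w)) * (corridorsBar L w v (Bs k)).card + Real.exp (-(κ / 4 * v)) * ((Bs k).card * (L : ℝ) ^ d))
            + 2 * ((∑ y : ↥((Λ.image fun y => y - σ (k + 1)) \ ((Cs k).image (fun x => x + τ k) ∪ corridors L w (Bs k))),
                Jc / (Real.cosh (θ * max (w : ℝ) (distToRegion ((Bs k).biUnion (box L)) y)) - 1)) / (γA - Jc / (Real.cosh (θ * w) - 1)) +
              ((1 + V * M / (γA - Jc)) ^ 2 * bs k ^ 2 *
              ∑ y : ↥((Λ.image fun y => y - σ (k + 1)) \ ((Cs k).image (fun x => x + τ k) ∪ corridors L w (Bs k))),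
                Jc / (Real.cosh (θ * max (w : ℝ) (distToRegion ((Bs k).biUnion (box L)) y)) - 1) *
                  (1 + distToRegion ((Is k).image fun x => x + τ k) y) ^ 2) / 2)
            + ∑ m ∈ Bs k, u k m))).le
  rwa [mul_one] at h

end StoppingIndex

end Literature.MathematicalPhysics.QuantumFieldTheory.Balaban1983to89.B1Eq324BenfattoKernelSect5PavementChainUpper

end
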